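import Mathlib.Analysis.MellinTransform
import Mathlib.Analysis.SpecialFunctions.Trigonometric.Sinc
import Mathlib.Analysis.Fourier.FourierTransform
import Mathlib.Analysis.SpecialFunctions.Integrals.Basic
import Mathlib.MeasureTheory.Measure.Lebesgue.Integral
import Mathlib.Analysis.Real.Pi.Bounds
import Literature.NumberTheory.ConnesConsani2021.ArchimedeanDictionary
import Literature.NumberTheory.LFunctions.RiemannSiegel
import Literature.NumberTheory.LFunctions.RiemannSiegelFacts
import Literature.NumberTheory.LFunctions.WeilExplicitArchParitySech
import HarnessLib

/-!
# Connes–Consani 2021, §1–§2: `W_∞ = L − D` via Schwartz kernels — STATEMENT LAYER (RH-FREE)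

LABEL (line 1): **RH-FREE corpus literature** — the archimedean explicit-formula kernels of
A. Connes, C. Consani, *Weil positivity and trace formula, the archimedean place*, Selecta Math.
(N.S.) 27 (2021) 77 = arXiv:2006.13771 [bib: `ConnesConsani2021`], **§1 "Geometric interpretation
of `Tr(f̂ u* đu)`"** (arXiv running items Lemma 4, Remark 5, Lemma 6, Lemma 7, Proposition 8; arXiv
pp. 7–9 = text chunks p0007–p0009) and **§2 "The square `Δ` and the trace-remainder"** (Definition 9
= Def. 2.1, Proposition 10 = Prop. 2.2, Corollary 11 = Cor. 2.3; pp. 10–11 = chunks p0010–p0011).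
Numbering: the journal numbers statements within sections (dictionary `pub-rhdoor/CC-MAP.md` §3:
Prop 10 = Prop 2.2, Cor 11 = Cor 2.3; for §1, pinned from the printed text by `rh-crit-cc-ref`:
Lemma 4 = Lemma 1.1, Remark 5 = Remark 1.2, Lemma 6 = Lemma 1.3, Lemma 7 = Lemma 1.4, Proposition 8
= Proposition 1.5); the headings below keep the arXiv running numbers of the source chunks, and every
`[cite:]` tag gives the journal number first, the arXiv item in parentheses and the chunk locator
`pNNNN:Lnn`.
Cell `rh-crit`, sub-cell `cc/`, typer seat t1 (statements first; discharge of the named facts is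
the second phase, order D3 of `cc/ASSIGNMENTS.md`).  bears_on: W-C/W-P (apex input (A), the weak
trace formula chain `W_∞ = L − D → W_∞ = Tr(ϑ·𝐒) − E`).  WHAT THIS IS NOT: any claim about RH;
positivity statements at the archimedean place never reach the critical strip; nothing in this
file bears on the truth of RH.

## What is printed, and how it is typed here

The section works in `L²(ℝ)_ev` (`⟨ξ|η⟩ = ½∫_ℝ ξ̄η = ∫₀^∞ ξ̄η`, eq. (8) p. 7) and in the isomorphic
`L²(ℝ₊*, d*λ)` through the unitary `w`, `(wξ)(λ) := λ^{1/2} ξ(λ)` (eq. (9) «wiso» p. 7), with the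
multiplicative Fourier transform `𝔽_μ(f)(s) := ∫₀^∞ f(v) v^{-is} d*v` (eq. (11) «PhiFourier»),
`T^w := wTw⁻¹`, `T^g := 𝔽_μ⁻¹ T 𝔽_μ`, the inversion `I : λ ↦ λ⁻¹`, the projection
`P` = multiplication by `1_{[1,∞)}` (eq. (17) «sch5»), `P̂ := (𝔽_{e_ℝ}^w)⁻¹ P 𝔽_{e_ℝ}^w`
(Prop. 2.2 (iii)), the unitary `u_∞ :=` multiplication by `u_∞(s) = e^{2iθ(s)}` (`θ` = Riemann–Siegel
angular function, eq. (14) «uinfty», App. B eq. (84) «riesie»), its quantized differential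
`đu_∞ = [H, u_∞]` with `H^g = 2P − 1` (Lemma 7 (ii)), and the scaling representation
`(ϑ(λ)ξ)(v) = ξ(λ⁻¹v)` on `L²(ℝ₊*)` (eq. (19) «vrepdefnfirst»).

Mathlib has no trace class, no Schwartz-kernel calculus and no Bochner-integrated `ϑ(f)`; the cell
lead's rigour map (`pub-rhdoor/lit/CC2021-RIGOUR-MAP.md` §4 W1) prescribes the recast used by the
tree's `ArchimedeanSoninTrace.lean` ("How the trace is typed": traces of POSITIVE operators as
suprema of finite orthonormal partial sums of `soninTraceForm`; plain functions; additive avatar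
`k = f ∘ exp`, `d*ρ = dt`).  Item by item:

| printed item (locator) | content | Lean (this file) | status |
|---|---|---|---|
| eq. (9) `w`, Lemma 4 (p0007:L25) | kernel of `T^w` is `k^w(λ,μ) = λ^{1/2}μ^{1/2}k(λ,μ)`; `Tr T = ∫ k(x,x)dx = ∫ k^w(λ,λ)d*λ` | `sqrtWeight`, `sqrtWeightKernel`, `sqrtWeight_integralOp`, `setIntegral_diag_eq_sqrtWeightKernel` | PROVED |
| Remark 5 (p0007:L45) | restriction to `L²(ℝ)_ev` has kernel `t(x,y) + t(x,−y)`; `Tr(T_ev) = ½∫(t(x,x)+t(x,−x))dx` | `evenRestrKernel`, `integral_eq_setIntegral_evenRestrKernel`, `setIntegral_evenRestrKernel_diag` | PROVED |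
| eq. (11) `𝔽_μ` (p0007:L58) | `𝔽_μ(f)(s) = ∫₀^∞ f(v)v^{-is}d*v` | Mathlib `mellin f (−is)`; `= mulFourier g` of the tree for `f = g ∘ log` (`mulFourier_eq_mellin_mulLift`) | PROVED dictionary |
| eq. (14) `u_∞` (p0007:L84) | `u_∞(s) = e^{2iθ(s)}` | `archUnitary` over the tree's `riemannSiegelTheta` | def; `‖u_∞‖ = 1` PROVED |
| Lemma 6 (p0007:L76) | `𝔽_{e_ℝ}^w = I ∘ u_∞^g` | display (FwIPhi) p0007:L89–L103 PROVED (`sqrtWeight_fourier_invSqrtEvenExt`, `archOp_eq_sqrtWeight_fourier_inv`); the identification of the Mellin multiplier of that operator with `u_∞` = NAMED FACT `CC2021_lemma_6` | FACT (RH-FREE) |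
| Lemma 7 (i) (p0007:L107) | kernel of `u_∞^g` is `k^u(λ,μ) = 2λ^{-1/2}μ^{1/2}cos(2πμ/λ)` | `archKernel`, `archOp` (the operator WITH this kernel; by the proved display it is `I∘𝔽_{e_ℝ}^w`, by Lemma 6 it is `u_∞^g`) | def + PROVED display |
| Lemma 7 (ii) (p0007:L111) | kernel of `(½đu_∞)^g = [P, u_∞^g]` is `(P(λ)−P(μ))k^u(λ,μ)` | `archStep`, `archCommKernel`, generic `commutator_integralOp_eq` | PROVED (kernel algebra) |
| Lemma 7 (iii), Prop. 8 (i)(ii) (p0007:L116–p0008:L29) | kernels `ℓ(ν,μ)`, `ℓ_ρ`, and `τ(ρ) = 4ρ^{1/2}∫∫_{x,y>0} cos(2πρxy)cos(2πxy)(P(1/y)−P(x))dydx` "formally given by" | NOT typed as Lean integrals: the `Σ`-part `∫₁^∞ cos·cos·log t dt` (eq. (21) «sch10») diverges (oscillatory, distributional — the source says "formally"); Lean's `∫` would return a junk `0`.  Recorded here; the `Δ`-part is honest and typed (`deltaSquareIntegral`, `IDelta`) | recorded |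
| Prop. 8 (iii) (p0008:L30; proof p0008:L43–p0009:L27) | `τ` is the Weil distribution `W_ℝ = −W_∞`: `τ(ρ) = (ρ^{1/2}/2)(1/(1+ρ) + 1/|1−ρ|)` (eq. (24) «sch12») with Weil's principal value at `ρ = 1` | `weilTau` (closed form, away from `ρ = 1`), `weilTau_of_one_lt/_of_lt_one/_inv/_exp` and the printed consistency check with Bombieri's `𝒲_ℝ` (p0009:L46–L63) as `archW_eq_neg_setIntegral_weilTau` (for `f(1) = 0`, where no principal value is needed) | PROVED |
| Prop. 8 (iv) (p0008:L31) | `ϑ(f)·½(u*_∞đu_∞)^g` is trace class, `Tr = ∫ f(ρ⁻¹)τ(ρ)d*ρ` | trace class not typable (Mathlib); by `(u^g)*Pu^g = 1 − P̂` (proof of Prop. 2.2 (iii), p0010:L59) the operator `½(u*đu)^g` is `1 − P − P̂` in `L²(ℝ)_ev`, so (iv) is Connes' archimedean local trace formula `W_∞(f) = Tr(ϑ(f)(P + P̂ − 1))` [Co-zeta]; its computable content is (iii) | recorded |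
| Def. 2.1 = Def 9 (p0010:L7) | `δ(ρ) := Tr((ϑ(ρ⁻¹) − Pϑ(ρ⁻¹)P)·½(u*_∞đu_∞)^g)` | `traceRemainder`, DEFINED by the printed closed form eq. (25) «sch13» (Sine integrals) for `ρ ≥ 1` and the printed symmetry (ii) for `ρ < 1`; the trace characterisation is carried by the facts `CC2021_prop_2_2_i/iii` (and §4 Lemma 21, seat t3) | def (recast, documented) |
| Prop. 2.2 = Prop 10 (i) (p0010:L15) | `δ(ρ) = 4ρ^{1/2}∫_Δ cos(2πρxy)cos(2πxy)dydx`, `ρ ≥ 1` | NAMED FACT `CC2021_prop_2_2_i` (in the recast: eq. (sch9) + `∫₀¹cos(2πat)(−log t)dt = Si(2πa)/(2πa)` + product-to-sum, all printed p0008–p0011) | FACT (RH-FREE; to be discharged, D3) |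
| Prop. 2.2 (ii) (p0010:L19) | `δ(ρ⁻¹) = δ(ρ)` | `traceRemainder_inv` | PROVED (definitional in the recast — SAID SO) |
| Prop. 2.2 (iii) (p0010:L20) | `Tr(ϑ(f)PP̂P) = ∫ f(ρ⁻¹)(δ(ρ) − τ(ρ))d*ρ` | NAMED FACT `CC2021_prop_2_2_iii`, weak form for `f = g ∗ g*` (sup of ON partial sums over `P̂L²(ℝ)_ev = soninSpace 0 1`), right side `traceL k = archW k + remainderD k` | FACT (RH-FREE) |
| eq. (25) «sch13», (26), `δ > 0` (p0011:L12–L18) | `Si` closed form, expansion at `ρ = 1`, positivity | `sinIntegral`, `traceRemainderAux`, `traceRemainder_one` (value `2(Si(4π)/(4π)+1)`), `traceRemainder_pos`; (26) to first order: `hasDerivWithinAt_traceRemainder_Ici_one` (`δ′(1⁺) = 1`), `hasDerivWithinAt_traceRemainder_Iic_one` (`δ′(1⁻) = −1`), `not_differentiableAt_traceRemainder_one` (the jump), `continuousOn_traceRemainder` | def / PROVED (the printed second-order coefficient of (26) is not formalised) |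
| Cor. 2.3 = Cor 11 (i) (p0011:L23) | `L(f) = ∫ f(ρ⁻¹)(δ−τ)d*ρ ≥ 0` on the convolution algebra | NAMED FACT `CC2021_cor_2_3_i`; PROVED from Prop. 2.2 (iii) (`cor_2_3_i_of_prop_2_2_iii`); consequence `W_∞ ≥ −D` PROVED (`neg_remainderD_le_archW`) | FACT + reductions |
| Cor. 2.3 (ii) (p0011:L27) | `2θ′(t) + δ̂(t) ≥ 0`, `δ̂(t) = ∫ δ(ρ)ρ^{-it}d*ρ` | NAMED FACT `CC2021_cor_2_3_ii` over `riemannSiegelThetaDeriv` and `mulFourier (δ ∘ exp)` | FACT (RH-FREE) |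

Dictionary with the tree (cited, never restated): `W_∞ = archW = weilArchTermBombieri`
(`ArchimedeanSoninTrace`, `ArchimedeanDictionary.ccWInfty_mulLift`), CC's `f̂ = mulFourier`,
`⟨ξ|ϑ(f)ξ⟩ = soninTraceForm`, `ϑ`-coefficients `scalingCoeff`, Sonin spaces `soninSpace α β`
(`P̂ L²(ℝ)_ev = soninSpace 0 1`, `P L²(ℝ)_ev = soninSpace 1 0`: the other cutoff condition is vacuous,
`mem_soninSpace_zero_left_iff`), `θ = riemannSiegelTheta`, `θ′ = riemannSiegelThetaDeriv`
(`Literature/NumberTheory/LFunctions/RiemannSiegel.lean`), test functions `IsWeilTest`, `weilConv`,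
`weilReflect`.  No instance, no notation, no attribute is introduced.

## Deliberately NOT here

§3 (vanishing conditions, `Q`; seat t2 / `VanishingIdealReduction`), §4 (pairs of projections
`𝒫₁ = 1 − P`, `𝒫̂₁ = 1 − P̂`, prolate vectors, Lemma 21 `δ(ρ) = Tr(ϑ(ρ⁻¹)𝒫̂₁𝒫₁)`, Thm. 4.7; seats
t3/t4), the figures and numerical checks of §2 (Figures 3–6), and any operator-trace object beyond
the weak forms above.
-/

noncomputable section

open _root_.MeasureTheory Complex Set Real FourierTransform
open scoped Real ComplexConjugate ContDiff

namespace Literature.NumberTheory.ConnesConsani2021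

open Literature.NumberTheory.LFunctions

/-! ## §1 set-up: the unitary `w` and Schwartz kernels (Lemma 4, Remark 5) -/

/-- The unitary `w : L²(ℝ)_ev → L²(ℝ₊*, d*λ)`, `(wξ)(λ) := λ^{1/2} ξ(λ)` (eq. (9) «wiso», §1 p. 7),
written on plain functions. [cite: ConnesConsani2021, §1 eq. (9) p. 7 (arXiv chunk p0007:L16)] -/
def sqrtWeight (ξ : ℝ → ℂ) (x : ℝ) : ℂ :=
  (Real.sqrt x : ℂ) * ξ x

/-- The kernel `k^w(λ, μ) := λ^{1/2} μ^{1/2} k(λ, μ)` of `T^w = wTw⁻¹` with respect to `d*μ`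
(Lemma 4, eq. (10) «sch1», §1 p. 7). [cite: ConnesConsani2021, §1 Lemma 1.1 (arXiv: Lemma 4) eq. (10) p. 7 (chunk p0007:L25–L31)] -/
def sqrtWeightKernel (k : ℝ → ℝ → ℂ) (x y : ℝ) : ℂ :=
  (Real.sqrt x : ℂ) * (Real.sqrt y : ℂ) * k x y

/-- **Lemma 4** (§1 p. 7, arXiv item 4 = journal Lemma 1.1): if `(Tξ)(x) = ∫_{y ≥ 0} k(x,y)ξ(y)dy` then
`T^w = wTw⁻¹` has Schwartz kernel `k^w(λ,μ) = λ^{1/2}μ^{1/2}k(λ,μ)` in `L²(ℝ₊*, d*μ)`, i.e.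
`w(Tξ)(λ) = ∫ k^w(λ,μ) (wξ)(μ) d*μ` (`d*μ = dμ/μ`).  PROVED (pointwise algebra under the integral;
no integrability needed since both integrands agree on `(0,∞)`).
[cite: ConnesConsani2021, §1 Lemma 1.1 (arXiv: Lemma 4) p. 7 (chunk p0007:L25–L43)] -/
theorem sqrtWeight_integralOp (k : ℝ → ℝ → ℂ) (ξ : ℝ → ℂ) (x : ℝ) :
    sqrtWeight (fun x' => ∫ y in Ioi (0 : ℝ), k x' y * ξ y) x =
      ∫ y in Ioi (0 : ℝ), sqrtWeightKernel k x y * sqrtWeight ξ y / y := by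
  simp only [sqrtWeight, sqrtWeightKernel]
  rw [← integral_const_mul]
  refine setIntegral_congr_fun measurableSet_Ioi (fun y hy => ?_)
  have hy0 : (0 : ℝ) < y := hy
  have hyy : (Real.sqrt y : ℂ) * (Real.sqrt y : ℂ) = (y : ℂ) := by
    rw [← Complex.ofReal_mul, Real.mul_self_sqrt hy0.le]
  have hy' : (y : ℂ) ≠ 0 := by exact_mod_cast hy0.ne'
  rw [show (Real.sqrt x : ℂ) * (Real.sqrt y : ℂ) * k x y * ((Real.sqrt y : ℂ) * ξ y) / y =
      (Real.sqrt x : ℂ) * (k x y * ξ y) * ((Real.sqrt y : ℂ) * (Real.sqrt y : ℂ) / y) by ring,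
    hyy, div_self hy', mul_one]

/-- **Lemma 4, trace clause** (§1 p. 7): "the trace of `T`, namely `∫_{x ≥ 0} k(x,x)dx`, is equal to
`∫ k^w(λ,λ) d*λ`".  PROVED as the identity of the two diagonal integrals.
[cite: ConnesConsani2021, §1 Lemma 1.1 (arXiv: Lemma 4) p. 7 (chunk p0007:L33)] -/
theorem setIntegral_diag_eq_sqrtWeightKernel (k : ℝ → ℝ → ℂ) :
    ∫ x in Ioi (0 : ℝ), k x x = ∫ x in Ioi (0 : ℝ), sqrtWeightKernel k x x / x := by
  refine setIntegral_congr_fun measurableSet_Ioi (fun x hx => ?_)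
  have hx0 : (0 : ℝ) < x := hx
  have hxx : (Real.sqrt x : ℂ) * (Real.sqrt x : ℂ) = (x : ℂ) := by
    rw [← Complex.ofReal_mul, Real.mul_self_sqrt hx0.le]
  have hx' : (x : ℂ) ≠ 0 := by exact_mod_cast hx0.ne'
  rw [sqrtWeightKernel, hxx, mul_comm, mul_div_assoc, div_self hx', mul_one]

/-- The kernel `k(x,y) := t(x,y) + t(x,−y)` on `x, y ≥ 0` of the restriction `T_ev` to `L²(ℝ)_ev` of
an operator `T` on `L²(ℝ)` with kernel `t` commuting with `ξ ↦ ξ(−·)` (Remark 5, §1 p. 7).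
[cite: ConnesConsani2021, §1 Remark 1.2 (arXiv: Remark 5) p. 7 (chunk p0007:L45)] -/
def evenRestrKernel (t : ℝ → ℝ → ℂ) (x y : ℝ) : ℂ :=
  t x y + t x (-y)

/-- **Remark 5** (§1 p. 7): on an even function `ξ`, `∫_ℝ t(x,y)ξ(y)dy = ∫_{y>0}(t(x,y)+t(x,−y))ξ(y)dy`
— the restriction `T_ev` "is of the form (sch0) with `k(x,y) = t(x,y) + t(x,−y)`".  PROVED
(split `ℝ = (−∞,0] ∪ (0,∞)` and reflect). [cite: ConnesConsani2021, §1 Remark 1.2 (arXiv: Remark 5) p. 7 (chunk p0007:L45)] -/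
theorem integral_eq_setIntegral_evenRestrKernel {t : ℝ → ℝ → ℂ} {ξ : ℝ → ℂ} {x : ℝ}
    (hξ : ∀ y, ξ (-y) = ξ y) (hint : Integrable (fun y => t x y * ξ y)) :
    ∫ y, t x y * ξ y = ∫ y in Ioi (0 : ℝ), evenRestrKernel t x y * ξ y := by
  have hneg : Integrable (fun y => t x (-y) * ξ y) := by
    have := hint.comp_neg
    simpa only [hξ] using this
  rw [← intervalIntegral.integral_Iic_add_Ioi hint.integrableOn hint.integrableOn]
  have h1 : ∫ y in Iic (0 : ℝ), t x y * ξ y = ∫ y in Ioi (0 : ℝ), t x (-y) * ξ y := by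
    have h := integral_comp_neg_Iic 0 (fun z => t x (-z) * ξ z)
    simp only [neg_neg, neg_zero, hξ] at h
    exact h
  rw [h1, ← integral_add hneg.integrableOn hint.integrableOn]
  refine setIntegral_congr_fun measurableSet_Ioi (fun y _ => ?_)
  simp only [evenRestrKernel]
  ring

/-- **Remark 5, trace clause** (§1 p. 7): if `t(−x,−y) = t(x,y)` then
`Tr(T_ev) = ∫_{x ≥ 0} k(x,x)dx = ½∫_ℝ (t(x,x) + t(x,−x))dx` ("the trace of the composition of `T`
with the projection `½(1+s)`").  PROVED as the identity of integrals (the integrand is even).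
[cite: ConnesConsani2021, §1 Remark 1.2 (arXiv: Remark 5) p. 7 (chunk p0007:L45–L49)] -/
theorem setIntegral_evenRestrKernel_diag {t : ℝ → ℝ → ℂ} (ht : ∀ x y, t (-x) (-y) = t x y)
    (hint : Integrable (fun x => t x x + t x (-x))) :
    ∫ x in Ioi (0 : ℝ), evenRestrKernel t x x = (1 / 2 : ℂ) * ∫ x, (t x x + t x (-x)) := by
  have heven : ∀ x, t (-x) (-x) + t (-x) (-(-x)) = t x x + t x (-x) := by
    intro x
    rw [neg_neg, ht x x, ← ht (-x) x, neg_neg, add_comm]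
  have h1 : ∫ x in Iic (0 : ℝ), (t x x + t x (-x)) = ∫ x in Ioi (0 : ℝ), (t x x + t x (-x)) := by
    have h := integral_comp_neg_Iic 0 (fun z => t z z + t z (-z))
    simp only [neg_zero, heven] at h
    exact h
  rw [← intervalIntegral.integral_Iic_add_Ioi hint.integrableOn hint.integrableOn, h1]
  simp only [evenRestrKernel]
  ring

/-! ## §1: `𝔽_μ`, `u_∞`, the kernel `k^u` (Lemma 6, Lemma 7) -/

/-- Dictionary for eq. (11) «PhiFourier» (§1 p. 7): CC's multiplicative Fourier transform
`𝔽_μ(f)(s) = ∫₀^∞ f(v)v^{-is}d*v` is Mathlib's `mellin f (−is)`, and on `f = g ∘ log` it is the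
tree's `mulFourier g s = ∫_ℝ g(t)e^{-ist}dt` (substitution `v = e^t`).  PROVED.
[cite: ConnesConsani2021, §1 eq. (11) p. 7 (chunk p0007:L58); App. A p. 30] -/
theorem mulFourier_eq_mellin_mulLift (g : ℝ → ℂ) (s : ℝ) :
    mulFourier g s = mellin (mulLift g) (-(s * I)) := by
  unfold mulFourier mellin mulLift
  have hcv := integral_image_eq_integral_abs_deriv_smul (s := univ) (f := Real.exp)
    (f' := Real.exp) MeasurableSet.univ (fun x _ => (Real.hasDerivAt_exp x).hasDerivWithinAt)
    Real.exp_injective.injOn (fun v : ℝ => (v : ℂ) ^ (-(s * I) - 1) • g (Real.log v))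
  rw [Set.image_univ, Real.range_exp] at hcv
  rw [hcv, setIntegral_univ]
  refine integral_congr_ae (Filter.Eventually.of_forall fun t => ?_)
  simp only [Real.log_exp, abs_of_pos (Real.exp_pos t)]
  have hcpow : ((Real.exp t : ℝ) : ℂ) ^ (-((s : ℂ) * I) - 1) = cexp ((t : ℂ) * (-((s : ℂ) * I) - 1)) := by
    rw [Complex.ofReal_exp, Complex.cpow_def_of_ne_zero (Complex.exp_ne_zero _),
      Complex.log_exp (by simp [Real.pi_pos]) (by simp [Real.pi_pos.le])]
  rw [Complex.real_smul, smul_eq_mul, hcpow, Complex.ofReal_exp, ← mul_assoc, ← Complex.exp_add,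
    show (t : ℂ) + (t : ℂ) * (-((s : ℂ) * I) - 1) = -(I * s * t) by ring, mul_comm]

/-- The unitary `u_∞` of the archimedean local functional equation, `u_∞(s) := e^{2iθ(s)}` with
`θ` the Riemann–Siegel angular function (eq. (14) «uinfty», §1 p. 7; App. B eq. (84) «riesie» p. 31:
`θ(E) = −(E/2) log π + Im log Γ(1/4 + iE/2)`), over the tree's `riemannSiegelTheta`.
[cite: ConnesConsani2021, §1 eq. (14) p. 7 (chunk p0007:L84); App. B eq. (84) p. 31] -/
def archUnitary (s : ℝ) : ℂ :=
  cexp (2 * (riemannSiegelTheta s : ℂ) * I)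

/-- `|u_∞(s)| = 1` ("`u_∞` is of modulus one", proof of Prop. 8 (iv), p. 9). [cite: ConnesConsani2021, §1 p. 9 (chunk p0009:L32)] -/
theorem norm_archUnitary (s : ℝ) : ‖archUnitary s‖ = 1 := by
  rw [archUnitary, show (2 * (riemannSiegelTheta s : ℂ) * I) = ((2 * riemannSiegelTheta s : ℝ) : ℂ) * I
    by push_cast; ring, Complex.norm_exp_ofReal_mul_I]

/-- The Schwartz kernel `k^u(λ, μ) := 2 λ^{-1/2} μ^{1/2} cos(2πμ/λ)` in `L²(ℝ₊*, d*μ)` (Lemma 7 (i),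
eq. (16) «sch4», §1 p. 7). [cite: ConnesConsani2021, §1 Lemma 1.4 (i) (arXiv: Lemma 7 (i)) eq. (16) p. 7 (chunk p0007:L107–L110)] -/
def archKernel (l m : ℝ) : ℝ :=
  2 * (Real.sqrt l)⁻¹ * Real.sqrt m * Real.cos (2 * π * m / l)

/-- The integral operator on functions on `ℝ₊*` with kernel `k^u` for `d*μ`:
`(archOp ξ)(λ) := ∫₀^∞ k^u(λ,μ) ξ(μ) dμ/μ = λ^{-1/2}∫ 2cos(2πμ/λ) μ^{1/2}ξ(μ) d*μ` — the operator
written `I ∘ w ∘ 𝔽_{e_ℝ} ∘ w⁻¹` in the display (FwIPhi) of §1 p. 7 (PROVED below: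
`archOp_eq_sqrtWeight_fourier_inv`), which Lemma 6 identifies with `u_∞^g = 𝔽_μ⁻¹u_∞𝔽_μ` and whose
kernel Lemma 7 (i) records. [cite: ConnesConsani2021, §1 Lemma 1.4 (i) (arXiv: Lemma 7 (i)) p. 7 (chunk p0007:L97–L110)] -/
def archOp (ξ : ℝ → ℂ) (l : ℝ) : ℂ :=
  ∫ m in Ioi (0 : ℝ), (archKernel l m : ℂ) * ξ m / m

/-- `w⁻¹ξ` extended to an even function on `ℝ`: `x ↦ |x|^{-1/2} ξ(|x|)` (the function
`|x|^{-1/2}ξ(|x|)` integrated in display (FwIPhi), §1 p. 7). [cite: ConnesConsani2021, §1 p. 7 (chunk p0007:L89–L92)] -/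
def invSqrtEvenExt (ξ : ℝ → ℂ) (x : ℝ) : ℂ :=
  ((Real.sqrt |x|)⁻¹ : ℝ) * ξ |x|

/-- **Display (FwIPhi), first line** (§1 p. 7, from the proof of Lemma 6): for `ξ` on `ℝ₊*`,
`(w ∘ 𝔽_{e_ℝ} ∘ w⁻¹)(ξ)(v) = v^{1/2}∫_ℝ |x|^{-1/2}ξ(|x|)e^{-2πixv}dx
 = v^{1/2}∫_{ℝ₊*} u^{1/2}ξ(u)(e^{2πiuv} + e^{-2πiuv}) d*u`, with Mathlib's `𝓕` (kernel `e^{-2πixv}`,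
eq. (13) p. 7).  PROVED (split at `0`, reflect the negative half-line).
[cite: ConnesConsani2021, §1 proof of Lemma 1.3 (arXiv: Lemma 6), display (FwIPhi) p. 7 (chunk p0007:L89–L95)] -/
theorem sqrtWeight_fourier_invSqrtEvenExt {ξ : ℝ → ℂ} (hξ : Integrable (invSqrtEvenExt ξ)) (v : ℝ) :
    sqrtWeight (𝓕 (invSqrtEvenExt ξ)) v =
      (Real.sqrt v : ℂ) * ∫ u in Ioi (0 : ℝ), (Real.sqrt u : ℂ) * ξ u *
        (cexp (↑(2 * π * u * v) * I) + cexp (↑(-2 * π * u * v) * I)) / u := by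
  unfold sqrtWeight
  congr 1
  rw [Real.fourier_real_eq_integral_exp_smul]
  simp only [smul_eq_mul]
  set G : ℝ → ℂ := fun x => cexp (↑(-2 * π * x * v) * I) * invSqrtEvenExt ξ x with hG
  have hGi : Integrable G := by
    refine hξ.bdd_mul (c := 1) (Continuous.aestronglyMeasurable (by fun_prop)) ?_
    exact Filter.Eventually.of_forall fun x => by rw [Complex.norm_exp_ofReal_mul_I]
  have hGn : Integrable (fun x => G (-x)) := hGi.comp_neg
  rw [← intervalIntegral.integral_Iic_add_Ioi hGi.integrableOn hGi.integrableOn]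
  have h1 : ∫ x in Iic (0 : ℝ), G x = ∫ x in Ioi (0 : ℝ), G (-x) := by
    have h := integral_comp_neg_Iic 0 (fun z => G (-z))
    simp only [neg_neg, neg_zero] at h
    exact h
  rw [h1, ← integral_add hGn.integrableOn hGi.integrableOn]
  refine setIntegral_congr_fun measurableSet_Ioi (fun x hx => ?_)
  have hx0 : (0 : ℝ) < x := hx
  have habs : |x| = x := abs_of_pos hx0
  have habs' : |-x| = x := by rw [abs_neg, habs]
  have hs : ((Real.sqrt x)⁻¹ : ℝ) = Real.sqrt x / x := by rw [Real.sqrt_div_self', one_div]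
  simp only [hG, invSqrtEvenExt, habs, habs']
  rw [hs]
  have hx' : (x : ℂ) ≠ 0 := by exact_mod_cast hx0.ne'
  push_cast
  field_simp

/-- **Display (FwIPhi), second line** (§1 p. 7): `(I ∘ w ∘ 𝔽_{e_ℝ} ∘ w⁻¹)(ξ)(λ)
 = (w𝔽_{e_ℝ}w⁻¹ξ)(λ⁻¹) = λ^{-1/2}∫_{ℝ₊*}(e^{2iπμ/λ} + e^{-2iπμ/λ}) μ^{1/2}ξ(μ)d*μ`, i.e. the
operator `I ∘ 𝔽_{e_ℝ}^w` is the integral operator `archOp` with kernel `k^u` of Lemma 7 (i).  PROVED.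
[cite: ConnesConsani2021, §1 display (FwIPhi) p. 7 (chunk p0007:L97–L103); Lemma 7 (i)] -/
theorem archOp_eq_sqrtWeight_fourier_inv {ξ : ℝ → ℂ} (hξ : Integrable (invSqrtEvenExt ξ)) (l : ℝ) :
    archOp ξ l = sqrtWeight (𝓕 (invSqrtEvenExt ξ)) l⁻¹ := by
  rw [sqrtWeight_fourier_invSqrtEvenExt hξ, archOp, ← integral_const_mul]
  refine setIntegral_congr_fun measurableSet_Ioi (fun m _ => ?_)
  have hsq : Real.sqrt l⁻¹ = (Real.sqrt l)⁻¹ := Real.sqrt_inv l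
  have h2cos : (((2 : ℝ) * Real.cos (2 * π * m / l) : ℝ) : ℂ) =
      cexp (↑(2 * π * m * l⁻¹) * I) + cexp (↑(-2 * π * m * l⁻¹) * I) := by
    have h2 := Complex.two_cos ((2 * π * m * l⁻¹ : ℝ) : ℂ)
    push_cast at h2 ⊢
    rw [div_eq_mul_inv, h2]
    simp only [neg_mul]
  simp only [archKernel, hsq]
  rw [show ((2 * (Real.sqrt l)⁻¹ * Real.sqrt m * Real.cos (2 * π * m / l) : ℝ) : ℂ) =
      ((Real.sqrt l)⁻¹ : ℝ) * (Real.sqrt m : ℂ) * (((2 : ℝ) * Real.cos (2 * π * m / l) : ℝ) : ℂ) by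
    push_cast; ring, h2cos]
  ring

/-- **Lemma 6** (§1 p. 7, arXiv item 6 = journal Lemma 1.3; NAMED FACT, RH-FREE).  As printed: "One has
`𝔽_{e_ℝ}^w = I ∘ u_∞^g`. Equivalently `𝔽_{e_ℝ} = w⁻¹ ∘ I ∘ 𝔽_μ⁻¹ ∘ u_∞ ∘ 𝔽_μ ∘ w`, where `u_∞` is the
multiplication operator by `u_∞(s) := e^{2iθ(s)}` and `θ(s)` is the Riemann–Siegel angular function."
Recast (module docstring): by the PROVED display (FwIPhi), `I ∘ 𝔽_{e_ℝ}^w` is the integral operator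
`archOp` (kernel `k^u`, Lemma 7 (i)); the lemma says `archOp = u_∞^g := 𝔽_μ⁻¹ u_∞ 𝔽_μ`, i.e.
`𝔽_μ(archOp ξ)(s) = u_∞(s)·𝔽_μ(ξ)(s)` (`𝔽_μ(f)(s) = mellin f (−is)`, eq. (11)), stated on the dense
subspace `C_c^∞(ℝ₊*)` where all integrals converge absolutely (both sides are bounded on `L²`, so this
is the printed identity of unitaries).  Equivalent to the Mellin transform of the cosine,
`2∫₀^∞cos(2πv)v^{is−1/2}dv = π^{-is}Γ(1/4+is/2)/Γ(1/4−is/2) = e^{2iθ(s)}` (duplication + reflection).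
The source recalls it as "Lemma 2.20 of *op. cit.*" (TeX: `Lemma 2.20 of \opcit`, the work just
cited being [CMbook] Chap. 2 §5.1), i.e. A. Connes, M. Marcolli, *Noncommutative Geometry, Quantum
Fields and Motives*, Chap. 2 Lemma 2.20 [cite: ConnesMarcolli2008, Chap. 2 Lemma 2.20], transported by
`w`; App. B p. 31 derives `u_∞` from Tate's local functional equation [tate].
[cite: ConnesConsani2021, §1 Lemma 1.3 (arXiv: Lemma 6) p. 7 (chunk p0007:L76–L86)] -/
def CC2021_lemma_6 : Prop :=
  ∀ ξ : ℝ → ℂ, ContDiff ℝ ∞ ξ → HasCompactSupport ξ → tsupport ξ ⊆ Ioi 0 →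
    ∀ s : ℝ, mellin (archOp ξ) (-(s * I)) = archUnitary s * mellin ξ (-(s * I))

/-- The cutoff `P(v) := 1` if `v ≥ 1`, `0` if `v < 1` (eq. (17) «sch5», §1 p. 7): the projection `P`
of `L²(ℝ₊*, d*λ)` is multiplication by `1_{[1,∞)}`, and `H^g = 2P − 1` (proof of Lemma 7 (ii), p. 8).
[cite: ConnesConsani2021, §1 Lemma 1.4 (ii) (arXiv: Lemma 7 (ii)) eq. (17) p. 7 (chunk p0007:L113)] -/
def archStep (v : ℝ) : ℝ :=
  if 1 ≤ v then 1 else 0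

/-- `P(v) = 1` for `v ≥ 1` (eq. (17) «sch5»). [cite: ConnesConsani2021, §1 eq. (17) p. 7 (chunk p0007:L113)] -/
theorem archStep_of_one_le {v : ℝ} (hv : 1 ≤ v) : archStep v = 1 := by
  simp [archStep, hv]

/-- `P(v) = 0` for `v < 1` (eq. (17) «sch5»). [cite: ConnesConsani2021, §1 eq. (17) p. 7 (chunk p0007:L114)] -/
theorem archStep_of_lt_one {v : ℝ} (hv : v < 1) : archStep v = 0 := by
  simp [archStep, not_le.2 hv]

/-- The kernel `(P(λ) − P(μ)) k^u(λ,μ)` of the quantized differential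
`(½ đu_∞)^g = [P, u_∞^g]` in `L²(ℝ₊*)` (Lemma 7 (ii), eq. (17) «sch5», §1 p. 7; `đT = [H,T]`,
`H^g = 2P − 1`). [cite: ConnesConsani2021, §1 Lemma 1.4 (ii) (arXiv: Lemma 7 (ii)) eq. (17) p. 7 (chunk p0007:L111–L115)] -/
def archCommKernel (l m : ℝ) : ℝ :=
  (archStep l - archStep m) * archKernel l m

/-- **Lemma 7 (ii), the kernel algebra** (proof p. 8: "for `T` with Schwartz kernel `k`, the kernel
of the commutator `[P,T]` is `(P(λ)−P(μ))k(λ,μ)`"), PROVED for an integral operator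
`(Tξ)(λ) = ∫₀^∞ k(λ,μ)ξ(μ)d*μ` and any multiplication operator `P`:
`P(λ)(Tξ)(λ) − (T(Pξ))(λ) = ∫ (P(λ)−P(μ))k(λ,μ)ξ(μ)d*μ`.
[cite: ConnesConsani2021, §1 Lemma 1.4 (ii) (arXiv: Lemma 7 (ii)), proof p. 8 (chunk p0008:L3)] -/
theorem commutator_integralOp_eq (P : ℝ → ℂ) (k : ℝ → ℝ → ℂ) (ξ : ℝ → ℂ) (l : ℝ)
    (h1 : IntegrableOn (fun m => k l m * ξ m / m) (Ioi 0))
    (h2 : IntegrableOn (fun m => k l m * (P m * ξ m) / m) (Ioi 0)) :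
    P l * (∫ m in Ioi (0 : ℝ), k l m * ξ m / m) - ∫ m in Ioi (0 : ℝ), k l m * (P m * ξ m) / m =
      ∫ m in Ioi (0 : ℝ), (P l - P m) * k l m * ξ m / m := by
  rw [← integral_const_mul, ← integral_sub (h1.const_mul _) h2]
  refine setIntegral_congr_fun measurableSet_Ioi (fun m _ => ?_)
  ring

/-- Lemma 7 (ii) for `u_∞^g`: `P(λ)(archOp ξ)(λ) − archOp(Pξ)(λ) = ∫ archCommKernel(λ,μ) ξ(μ) d*μ`
— the operator `[P, u_∞^g] = (½đu_∞)^g` has kernel `archCommKernel`.  PROVED (under integrability of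
the two kernel integrands). [cite: ConnesConsani2021, §1 Lemma 1.4 (ii) (arXiv: Lemma 7 (ii)) p. 7 (chunk p0007:L111–L115)] -/
theorem archStep_mul_archOp_sub (ξ : ℝ → ℂ) (l : ℝ)
    (h1 : IntegrableOn (fun m => (archKernel l m : ℂ) * ξ m / m) (Ioi 0))
    (h2 : IntegrableOn (fun m => (archKernel l m : ℂ) * ((archStep m : ℂ) * ξ m) / m) (Ioi 0)) :
    (archStep l : ℂ) * archOp ξ l - archOp (fun m => (archStep m : ℂ) * ξ m) l =
      ∫ m in Ioi (0 : ℝ), (archCommKernel l m : ℂ) * ξ m / m := by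
  rw [archOp, archOp, commutator_integralOp_eq (fun v => (archStep v : ℂ)) (fun a b => (archKernel a b : ℂ))
    ξ l h1 h2]
  refine setIntegral_congr_fun measurableSet_Ioi (fun m _ => ?_)
  simp only [archCommKernel]
  push_cast
  ring

/-! ## Prop. 8 (iii): the Weil distribution `τ = W_ℝ = −W_∞`

Prop. 8 (i)–(ii) (kernels `ℓ_ρ`, and `τ(ρ) = 4ρ^{1/2}∫∫ cos(2πρxy)cos(2πxy)(P(1/y)−P(x))dydx`
"formally given by") are distributional (module docstring) and are not typed as Lean integrals; the
`Δ`-part is typed below (`IDelta`, `deltaSquareIntegral`).  What (iii) computes (proof p. 8–9,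
eq. (24) «sch12») is the closed form of `τ` away from `ρ = 1`. -/

/-- The Weil distribution `τ(ρ) = (ρ^{1/2}/2)(1/(1+ρ) + 1/|1−ρ|)` (Prop. 8 (iii), eq. (24) «sch12»,
§1 p. 9; [CMbook] §4.2), as a FUNCTION on `ρ ≠ 1`: "`τ` … is not a function because of the
divergency at `ρ = 1`" (§2 p. 10) — at `ρ = 1` the printed object is Weil's principal value, and the
value here (`1/|0| = 0` in Lean, so `weilTau 1 = 1/4`) is a documented junk value never used.
[cite: ConnesConsani2021, §1 Prop. 1.5 (iii) (arXiv: Prop. 8 (iii)) eq. (24) p. 9 (chunk p0009:L26)] -/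
def weilTau (ρ : ℝ) : ℝ :=
  Real.sqrt ρ / 2 * (1 / (1 + ρ) + 1 / |1 - ρ|)

/-- "For `ρ > 1` one has `τ(ρ) = ρ^{3/2}/(ρ² − 1)`" (§1 p. 9).  PROVED.
[cite: ConnesConsani2021, §1 p. 9 (chunk p0009:L50)] -/
theorem weilTau_of_one_lt {ρ : ℝ} (hρ : 1 < ρ) :
    weilTau ρ = Real.sqrt ρ * ρ / (ρ ^ 2 - 1) := by
  have h1 : |1 - ρ| = ρ - 1 := by rw [abs_sub_comm]; exact abs_of_pos (by linarith)
  have h2 : (ρ - 1) ≠ 0 := by linarith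
  have h3 : (1 + ρ) ≠ 0 := by linarith
  have h4 : ρ ^ 2 - 1 ≠ 0 := by nlinarith
  rw [weilTau, h1]
  field_simp
  ring

/-- "For `ρ ≤ 1` one has `τ(ρ) = ρ^{1/2}/(1 − ρ²)`" (§1 p. 9; here `0 ≤ ρ < 1`).  PROVED.
[cite: ConnesConsani2021, §1 p. 9 (chunk p0009:L54)] -/
theorem weilTau_of_lt_one {ρ : ℝ} (hρ : ρ < 1) :
    weilTau ρ = Real.sqrt ρ / (1 - ρ ^ 2) := by
  have h1 : |1 - ρ| = 1 - ρ := abs_of_pos (by linarith)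
  have h2 : (1 - ρ) ≠ 0 := by linarith
  rcases eq_or_ne (1 + ρ) 0 with h3 | h3
  · have hρ' : ρ = -1 := by linarith
    subst hρ'
    have hs : Real.sqrt (-1 : ℝ) = 0 := Real.sqrt_eq_zero'.2 (by norm_num)
    simp [weilTau, hs]
  have h4 : 1 - ρ ^ 2 ≠ 0 := by
    rw [show (1 : ℝ) - ρ ^ 2 = (1 - ρ) * (1 + ρ) by ring]
    exact mul_ne_zero h2 h3
  rw [weilTau, h1]
  field_simp
  ring

/-- `τ(ρ⁻¹) = τ(ρ)` for `ρ > 0` (the symmetry used in `W_ℝ(f) = ∫ f(ρ⁻¹)τ(ρ)d*ρ = ∫ f(ρ)τ(ρ)d*ρ`,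
§1 p. 9).  PROVED. [cite: ConnesConsani2021, §1 p. 9 (chunk p0009:L48)] -/
theorem weilTau_inv {ρ : ℝ} (hρ : 0 < ρ) : weilTau ρ⁻¹ = weilTau ρ := by
  have hs : Real.sqrt ρ⁻¹ = (Real.sqrt ρ)⁻¹ := Real.sqrt_inv ρ
  have hsq : Real.sqrt ρ * Real.sqrt ρ = ρ := Real.mul_self_sqrt hρ.le
  have hs0 : Real.sqrt ρ ≠ 0 := (Real.sqrt_pos.2 hρ).ne'
  have habs : |1 - ρ⁻¹| = |1 - ρ| / ρ := by
    rw [show (1 : ℝ) - ρ⁻¹ = -(1 - ρ) / ρ by field_simp; ring, abs_div, abs_neg, abs_of_pos hρ]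
  rw [weilTau, weilTau, hs, habs]
  rcases eq_or_ne ρ 1 with rfl | h1
  · simp
  have hne : |1 - ρ| ≠ 0 := abs_ne_zero.2 (sub_ne_zero.2 (Ne.symm h1))
  have h1ρ : 1 + ρ⁻¹ = (1 + ρ) / ρ := by
    rw [eq_div_iff hρ.ne', add_mul, one_mul, inv_mul_cancel₀ hρ.ne', add_comm]
  rw [h1ρ]
  field_simp
  nlinarith [hsq]

/-- In the additive variable: for `t > 0`, `τ(e^t) = e^{3t/2}/(e^{2t} − 1) = e^{t/2}/(2 sinh t)` —
the integrand of Bombieri's `𝒲_ℝ` (App. B eq. (83)) transported by `x = e^t`, as in the tree's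
`weilArchTermBombieri`.  PROVED. [cite: ConnesConsani2021, §1 p. 9 (chunk p0009:L50); App. B eq. (83) p. 31] -/
theorem weilTau_exp {t : ℝ} (ht : 0 < t) :
    weilTau (Real.exp t) = Real.exp (t / 2) / (2 * Real.sinh t) := by
  have h1 : 1 < Real.exp t := Real.one_lt_exp_iff.2 ht
  rw [weilTau_of_one_lt h1]
  set a : ℝ := Real.exp (t / 2) with ha
  have ha0 : 0 < a := Real.exp_pos _
  have hexp : Real.exp t = a * a := by rw [ha, ← Real.exp_add]; ring_nf
  have hsqrt : Real.sqrt (Real.exp t) = a := by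
    rw [hexp, Real.sqrt_mul_self ha0.le]
  have hsinh : Real.sinh t = (a * a - (a * a)⁻¹) / 2 := by
    rw [Real.sinh_eq, ← hexp, Real.exp_neg]
  rw [hsqrt, hsinh, hexp]
  have ha1 : 1 < a := by rw [ha]; exact Real.one_lt_exp_iff.2 (by linarith)
  have h4 : (a * a) ^ 2 - 1 ≠ 0 := by nlinarith
  have h5 : a * a ≠ 0 := by positivity
  field_simp

/-- **Prop. 8 (iii), the printed consistency check with Bombieri's explicit formula** (§1 p. 9,
"One checks that (sch12) is coherent with the equality `W_ℝ(f) = 𝒲_ℝ(Δ^{-1/2}f)` … (assuming for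
simplicity `f(1) = 0`)"): for an additive test function `g` with `g(0) = 0` (`f(1) = 0`),
`W_∞(f) = −∫₁^∞ (f(ρ) + f(ρ⁻¹)) τ(ρ) d*ρ`, i.e. `archW g = −∫₀^∞ (g(t) + g(−t)) τ(e^t) dt`.  PROVED
(the tree's `archW = weilArchTermBombieri` is Bombieri's form; `τ(e^t) = e^{t/2}/(2 sinh t)`).  On the
hyperplane `f(1) = 0` no principal value is involved; the full distributional statement "`τ = W_ℝ`"
is this identity plus Weil's principal value at `ρ = 1`.
[cite: ConnesConsani2021, §1 Prop. 1.5 (iii) (arXiv: Prop. 8 (iii)) p. 8, consistency check p. 9 (chunk p0009:L46–L63)] -/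
theorem archW_eq_neg_setIntegral_weilTau (g : ℝ → ℂ) (hg0 : g 0 = 0) :
    archW g = -∫ t in Ioi (0 : ℝ), (g t + g (-t)) * (weilTau (Real.exp t) : ℂ) := by
  rw [archW, weilArchTermBombieri, hg0]
  simp only [mul_zero, zero_add, sub_zero]
  congr 1
  refine setIntegral_congr_fun measurableSet_Ioi (fun t ht => ?_)
  rw [weilTau_exp ht]
  push_cast
  ring

/-! ## §2: Sine integral, the trace-remainder `δ`, the functionals `D` and `L` -/

/-- The Sine integral `Si(z) := ∫₀^z sin(t)/t dt` (§2 p. 11, after eq. (24); real `z` here; the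
source notes it is entire in `z ∈ ℂ`).  (At `t = 0` Lean's `sin 0 / 0 = 0` changes nothing under the
integral.) [cite: ConnesConsani2021, §2 p. 11 (chunk p0011:L10)] -/
def sinIntegral (x : ℝ) : ℝ :=
  ∫ t in (0 : ℝ)..x, Real.sin t / t

/-- `Si(0) = 0` (immediate from the definition `Si(z) = ∫₀^z sin t/t dt`, §2 p. 11). [cite: ConnesConsani2021, §2 p. 11 (chunk p0011:L10)] -/
theorem sinIntegral_zero : sinIntegral 0 = 0 := by
  simp [sinIntegral]

/-- `|Si(x)| ≤ |x|` (from `|sin t| ≤ |t|`; cf. "`Si(x)/x ≤ 1` for `x > 0`", §2 p. 11).  PROVED.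
[cite: ConnesConsani2021, §2 p. 11 (chunk p0011:L47)] -/
theorem abs_sinIntegral_le (x : ℝ) : |sinIntegral x| ≤ |x| := by
  unfold sinIntegral
  have h := intervalIntegral.norm_integral_le_of_norm_le_const (a := (0 : ℝ)) (b := x) (C := 1)
    (f := fun t : ℝ => Real.sin t / t) (fun t _ => ?_)
  · simpa using h
  · rw [Real.norm_eq_abs, abs_div]
    rcases eq_or_ne t 0 with rfl | ht
    · simp
    · rw [div_le_one (abs_pos.2 ht)]
      exact Real.abs_sin_le_abs

/-- The closed form of the trace-remainder for `r ≥ 1` (eq. (25) «sch13», §2 p. 11):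
`δ(r) = 2r^{1/2}( Si(2π(1+r))/(2π(1+r)) + Si(2π(r−1))/(2π(r−1)) )`, with the removable
singularity of `Si(x)/x` at `x = 0` filled by its limit `1` (so that `δ(1) = 2(Si(4π)/(4π) + 1)`, the
constant term of the printed expansion (26) «chirem1»). [cite: ConnesConsani2021, §2 eq. (25)–(26) p. 11 (chunk p0011:L12–L15)] -/
def traceRemainderAux (r : ℝ) : ℝ :=
  2 * Real.sqrt r *
    (sinIntegral (2 * π * (1 + r)) / (2 * π * (1 + r)) +
      (if r = 1 then 1 else sinIntegral (2 * π * (r - 1)) / (2 * π * (r - 1))))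

/-- **The trace-remainder `δ`** (Definition 2.1 = Def 9, §2 p. 10: "`δ(ρ) := Tr((ϑ(ρ⁻¹) −
Pϑ(ρ⁻¹)P)·½(u*_∞ đu_∞)^g)`").  RECAST (module docstring): Mathlib has no trace class, so `δ` is
DEFINED here by its printed closed form eq. (25) for `ρ ≥ 1` and by the printed symmetry
`δ(ρ⁻¹) = δ(ρ)` (Prop. 2.2 (ii)) for `ρ < 1`, i.e. `δ(ρ) = traceRemainderAux (max ρ ρ⁻¹)`; the
identification with the trace is the content of the named facts `CC2021_prop_2_2_i` (square `Δ`) and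
`CC2021_prop_2_2_iii` (the functional `L`), and of §4 Lemma 21 (`δ(ρ) = Tr(ϑ(ρ⁻¹)𝒫̂₁𝒫₁)`, seat t3).
"`δ(ρ)` is a function … it fulfills the symmetry `δ(ρ) = δ(ρ⁻¹)`" (p. 10); it "has a jump in its
first derivative at `ρ = 1`" (p. 11, eq. (26)). [cite: ConnesConsani2021, §2 Def. 2.1 (= arXiv Def. 9) p. 10 (chunk p0010:L7–L10); eq. (25) p. 11] -/
def traceRemainder (ρ : ℝ) : ℝ :=
  traceRemainderAux (max ρ ρ⁻¹)

/-- For `ρ ≥ 1`, `δ(ρ)` is the closed form (25) at `ρ`. [cite: ConnesConsani2021, §2 eq. (25) p. 11 (chunk p0011:L12)] -/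
theorem traceRemainder_of_one_le {ρ : ℝ} (hρ : 1 ≤ ρ) : traceRemainder ρ = traceRemainderAux ρ := by
  rw [traceRemainder, max_eq_left ((inv_le_one_of_one_le₀ hρ).trans hρ)]

/-- **Prop. 2.2 (ii)** (§2 p. 10): "`δ(ρ) = δ(ρ⁻¹)` for all `ρ ∈ ℝ₊*`".  In print a theorem about the
trace of Def. 2.1 (adjointness of `½(u*đu)^g`, `R(ρ)* = R(ρ⁻¹)`); in this recast it holds BY
DEFINITION — SAID SO; the content moved into `CC2021_prop_2_2_i/iii`.  PROVED (all real `ρ`; the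
junk extension to `ρ ≤ 0` is harmless).
[cite: ConnesConsani2021, §2 Prop. 2.2 (ii) (= arXiv Prop. 10 (ii)) p. 10 (chunk p0010:L19, proof L50–L56)] -/
theorem traceRemainder_inv (ρ : ℝ) : traceRemainder ρ⁻¹ = traceRemainder ρ := by
  rw [traceRemainder, traceRemainder, inv_inv, max_comm]

/-- `δ(1) = 2(Si(4π)/(4π) + 1)` — the constant term of the printed expansion (26) of `δ` at `ρ = 1`.
PROVED. [cite: ConnesConsani2021, §2 eq. (26) p. 11 (chunk p0011:L15)] -/
theorem traceRemainder_one : traceRemainder 1 = 2 * (sinIntegral (4 * π) / (4 * π) + 1) := by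
  rw [traceRemainder_of_one_le le_rfl, traceRemainderAux]
  simp only [Real.sqrt_one, mul_one, if_true]
  ring_nf

/-- The `Δ`-integral of Prop. 2.2 (i): `∫_Δ cos(2πρxy)cos(2πxy)dydx` over the unit square
`Δ = {0 ≤ x ≤ 1, 0 ≤ y ≤ 1}` (proof of Prop. 8 (iii), p. 8; eq. (23) «rhoform» p. 10) — an honest
(absolutely convergent) integral, unlike its `Σ`-companion. [cite: ConnesConsani2021, §2 Prop. 2.2 (i) eq. (23) p. 10 (chunk p0010:L17); §1 p. 8 (chunk p0008:L45)] -/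
def deltaSquareIntegral (ρ : ℝ) : ℝ :=
  ∫ x in Ioc (0 : ℝ) 1, ∫ y in Ioc (0 : ℝ) 1, Real.cos (2 * π * ρ * x * y) * Real.cos (2 * π * x * y)

/-- `I(Δ) := ∫₀¹ cos(2πρt)cos(2πt)(−log t)dt` (eq. (20) «sch9», §1 p. 8: the square integral after the
area substitution `α(t) = t − t log t`, `dα = −log t dt`). [cite: ConnesConsani2021, §1 eq. (20) p. 8 (chunk p0008:L57–L61)] -/
def IDelta (ρ : ℝ) : ℝ :=
  ∫ t in (0 : ℝ)..1, Real.cos (2 * π * ρ * t) * Real.cos (2 * π * t) * (-Real.log t)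

/-- **Prop. 2.2 (i)** (§2 p. 10, = arXiv Prop. 10 (i); NAMED FACT, RH-FREE).  As printed: "For
`ρ ≥ 1` one has `δ(ρ) = 4ρ^{1/2}∫_Δ cos(2πρxy)cos(2πxy)dydx`."  In the recast (δ defined by (25)) this
is the printed computation p. 11: `∫_Δ = I(Δ)` (eq. (20)), `∫₀¹cos(2πat)(−log t)dt = Si(2πa)/(2πa)`,
`2cos x cos y = cos(x+y) + cos(x−y)`.  To be DISCHARGED (cc/ASSIGNMENTS D3).
[cite: ConnesConsani2021, §2 Prop. 2.2 (i) (= arXiv Prop. 10 (i)) eq. (23) p. 10 (chunk p0010:L15–L18); proof p0010:L25–L49, p0011:L1–L12] -/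
def CC2021_prop_2_2_i : Prop :=
  ∀ ρ : ℝ, 1 ≤ ρ → traceRemainder ρ = 4 * Real.sqrt ρ * deltaSquareIntegral ρ

/-- **The functional `D`** (§2 p. 11 "the functional defined by `δ`"; named `D(f) = ∫ f(ρ⁻¹)δ(ρ)d*ρ`
in §4 p. 15), in the additive avatar `k = f ∘ exp` (`d*ρ = dt`): `D(f) = ∫_ℝ k(t) δ(e^t) dt`
(using `δ(ρ⁻¹) = δ(ρ)`). [cite: ConnesConsani2021, §2 p. 11 (chunk p0011:L20); §4 p. 15 (chunk p0015:L3)] -/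
def remainderD (k : ℝ → ℂ) : ℂ :=
  ∫ t : ℝ, k t * (traceRemainder (Real.exp t) : ℂ)

/-- **The functional `L`** (Cor. 2.3 (i), eq. (29) «sch19», §2 p. 11):
`L(f) = ∫ f(ρ⁻¹)(δ(ρ) − τ(ρ))d*ρ = W_∞(f) + D(f)` (`−∫ f(ρ⁻¹)τ(ρ)d*ρ = −W_ℝ(f) = W_∞(f)` by Prop. 8
(iii)), typed through the tree's `archW` for the `τ`-part (principal value included) and `remainderD`;
"`W_∞ = L − D`" (Thm. 3 (devil), §4 p. 15) is then the definition read backwards, and the CONTENT is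
`L = Tr(ϑ(·)PP̂P) ≥ 0` (`CC2021_prop_2_2_iii`, `CC2021_cor_2_3_i`).
[cite: ConnesConsani2021, §2 Cor. 2.3 (i) (= arXiv Cor. 11) eq. (29) p. 11 (chunk p0011:L22–L26)] -/
def traceL (k : ℝ → ℂ) : ℂ :=
  archW k + remainderD k

/-- `W_∞ = L − D` (Theorem 3 / §4 p. 15 "`D` … is the difference `L − W_∞`"), definitional here.
[cite: ConnesConsani2021, §4 p. 15 (chunk p0015:L3)] -/
theorem archW_eq_traceL_sub_remainderD (k : ℝ → ℂ) : archW k = traceL k - remainderD k := by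
  rw [traceL, add_sub_cancel_right]

/-! ## Prop. 2.2 (iii) and Cor. 2.3 in weak form -/

/-- The projection `P` on `L²(ℝ)_ev`: "multiplication by the characteristic function of
`{x ∈ ℝ : |x| ≥ 1}`" (§4 p. 15, transporting the `P = 1_{[1,∞)}` of §1 eq. (17) by `w`), on plain
functions. [cite: ConnesConsani2021, §1 eq. (17) p. 7 (chunk p0007:L113); §4 p. 15 (chunk p0015:L52)] -/
def cutoffP (ξ : ℝ → ℂ) (v : ℝ) : ℂ :=
  if 1 ≤ |v| then ξ v else 0

/-- `P` is a projection (`P² = P`; "the projection `P`", §1 eq. (17) p. 7, §2 p. 10). [cite: ConnesConsani2021, §2 p. 10 (chunk p0010:L5)] -/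
theorem cutoffP_cutoffP (ξ : ℝ → ℂ) : cutoffP (cutoffP ξ) = cutoffP ξ := by
  funext v
  by_cases h : 1 ≤ |v| <;> simp [cutoffP, h]

/-- The range of `P̂ = 𝔽_{e_ℝ}⁻¹ P 𝔽_{e_ℝ}` in `L²(ℝ)_ev` is the tree's `soninSpace 0 1` (even, Fourier
transform vanishing a.e. on `[−1,1]`): the spatial cutoff condition of `soninSpace 0 β` is over the
null set `[−0,0] = {0}` and hence vacuous.  PROVED. [cite: ConnesConsani2021, Def. 4.4 §4 p. 16; Prop. 2.2 (iii) §2 p. 10] -/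
theorem mem_soninSpace_zero_left_iff (β : ℝ) (ξ : Lp ℂ 2 (volume : Measure ℝ)) :
    ξ ∈ soninSpace 0 β ↔
      (∀ᵐ x : ℝ, (ξ : ℝ → ℂ) (-x) = (ξ : ℝ → ℂ) x) ∧
      (∀ᵐ p : ℝ, p ∈ Icc (-β) β → ((𝓕 ξ : Lp ℂ 2 (volume : Measure ℝ)) : ℝ → ℂ) p = 0) := by
  rw [mem_soninSpace_iff]
  have hvac : ∀ᵐ x : ℝ, x ∈ Icc (-0 : ℝ) 0 → (ξ : ℝ → ℂ) x = 0 := by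
    rw [neg_zero, Icc_self]
    have : ∀ᵐ x : ℝ ∂volume, x ≠ 0 := by
      simp [ae_iff]
    filter_upwards [this] with x hx hx0
    exact absurd (mem_singleton_iff.1 hx0) hx
  exact ⟨fun h => ⟨h.1, h.2.2⟩, fun h => ⟨h.1, hvac, h.2⟩⟩

/-- **Prop. 2.2 (iii)** (§2 p. 10, = arXiv Prop. 10 (iii); NAMED FACT, RH-FREE).  As printed: "For
`f ∈ C_c^∞(ℝ₊*)`, and with `P̂ = (𝔽_{e_ℝ}^w)⁻¹P𝔽_{e_ℝ}^w`, one has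
`Tr(ϑ(f)PP̂P) = ∫₀^∞ f(ρ⁻¹)(δ(ρ) − τ(ρ))d*ρ`" (`= L(f)`, eq. (29)).  WEAK FORM (the tree's typing of
traces, `ArchimedeanSoninTrace` "How the trace is typed"): for `f = g ∗ g*` the operator
`ϑ(f)PP̂P`, read as `P̂Pϑ(g)ϑ(g)*PP̂ ≥ 0`, has trace `Σ_e ⟨Pe|ϑ(f)Pe⟩` over an orthonormal basis `e` of
`P̂L²(ℝ)_ev = soninSpace 0 1`, a sum of non-negative terms, hence the SUPREMUM of its finite partial
sums; `⟨Pe|ϑ(f)Pe⟩ = soninTraceForm k (cutoffP e)` (`k` = additive avatar of `f`; CC's factor `½` in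
`⟨·|·⟩` is absorbed as in `WeilArchPositivity_soninTrace`).  Statement: that supremum IS
`Re L(f) = Re(archW k + remainderD k)` (an `IsLUB`).  The printed proof: `PP̂P = −P·½(u*đu)^gP`,
trace-class of `ϑ(f)P½(u*đu)^g` (via `[P,ϑ(f)]` trace class and Prop. 8 (iv)), and Def. 2.1.
[cite: ConnesConsani2021, §2 Prop. 2.2 (iii) (= arXiv Prop. 10 (iii)) p. 10 (chunk p0010:L20–L23; proof L57–L76)] -/
def CC2021_prop_2_2_iii : Prop :=
  ∀ g : ℝ → ℂ, IsWeilTest g →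
    IsLUB {s : ℝ | ∃ (n : ℕ) (ξ : Fin n → Lp ℂ 2 (volume : Measure ℝ)),
        Orthonormal ℂ ξ ∧ (∀ i, ξ i ∈ soninSpace 0 1) ∧
          s = ∑ i, (soninTraceForm (weilConv g (weilReflect g)) (cutoffP (ξ i : ℝ → ℂ))).re}
      (traceL (weilConv g (weilReflect g))).re

/-- **Cor. 2.3 (i)** (§2 p. 11, = arXiv Cor. 11 (i); NAMED FACT, RH-FREE).  As printed: "The
following functional is positive on the convolution algebra `C_c^∞(ℝ₊*)`:
`L(f) = ∫ f(ρ⁻¹)(δ(ρ) − τ(ρ))d*ρ`", i.e. `L(g ∗ g*) ≥ 0` for every test function `g` (proof: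
"`L(f) := Tr(ϑ(f)PP̂P)` is positive for `f = g∗g*` as the trace of a product of two positive
operators").  Typed: `0 ≤ Re(archW k + remainderD k)`, `k = g ⋆ g̃`.  Follows from
`CC2021_prop_2_2_iii` (`cor_2_3_i_of_prop_2_2_iii`, PROVED); equivalently
`W_∞(g∗g*) ≥ −D(g∗g*)` (`neg_remainderD_le_archW`).
[cite: ConnesConsani2021, §2 Cor. 2.3 (i) (= arXiv Cor. 11 (i)) p. 11 (chunk p0011:L22–L29)] -/
def CC2021_cor_2_3_i : Prop :=
  ∀ g : ℝ → ℂ, IsWeilTest g → 0 ≤ (traceL (weilConv g (weilReflect g))).re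

/-- Cor. 2.3 (i) from Prop. 2.2 (iii): the empty orthonormal family has partial sum `0`, and a
supremum of a set containing `0` is `≥ 0` ("trace of a product of two positive operators").  PROVED.
[cite: ConnesConsani2021, §2 Cor. 2.3 (i), proof p. 11 (chunk p0011:L29)] -/
theorem cor_2_3_i_of_prop_2_2_iii (h : CC2021_prop_2_2_iii) : CC2021_cor_2_3_i := by
  intro g hg
  have hlub := h g hg
  exact hlub.1 ⟨0, (fun i => Fin.elim0 i), Orthonormal.of_isEmpty _, fun i => Fin.elim0 i, by simp⟩

/-- The consequence used in §3 (implication (control), §3/§4 p. 15): `W_∞(g∗g*) ≥ −D(g∗g*)`, i.e.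
"in order to prove Weil's positivity one needs to control the sign of the functional `D`".  PROVED from
Cor. 2.3 (i). [cite: ConnesConsani2021, §4 p. 15 (chunk p0015:L3)] -/
theorem neg_remainderD_le_archW (h : CC2021_cor_2_3_i) {g : ℝ → ℂ} (hg : IsWeilTest g) :
    -(remainderD (weilConv g (weilReflect g))).re ≤ (archW (weilConv g (weilReflect g))).re := by
  have := h g hg
  rw [traceL, Complex.add_re] at this
  linarith

/-- **Cor. 2.3 (ii)** (§2 p. 11, = arXiv Cor. 11 (ii); NAMED FACT, RH-FREE).  As printed: "The
function `2θ′(t) + δ̂(t)` is non-negative, where `δ̂(t) := ∫_{ℝ₊*} δ(ρ)ρ^{-it}d*ρ`."  Here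
`θ′ = riemannSiegelThetaDeriv` (the tree's `θ′(t) = Re ψ(1/4 + it/2)/2 − (log π)/2`) and
`δ̂ = mulFourier (δ ∘ exp)` (`∫ δ(ρ)ρ^{-it}d*ρ = ∫_ℝ δ(e^u)e^{-itu}du`; real, `δ ∘ exp` being even).
Printed proof: `L(f) = ∫ f̂(t)(2θ′(t) + δ̂(t))dt/2π` (eq. (30) «lfourier», from
`W_∞(f) = ∫ f̂(t)2θ′(t)dt/2π` and Parseval) and the positivity (i) ("in fact it is equivalent to").
[cite: ConnesConsani2021, §2 Cor. 2.3 (ii) (= arXiv Cor. 11 (ii)) p. 11 (chunk p0011:L27; proof L30–L41)] -/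
def CC2021_cor_2_3_ii : Prop :=
  ∀ t : ℝ, 0 ≤ 2 * riemannSiegelThetaDeriv t +
    (mulFourier (fun u : ℝ => (traceRemainder (Real.exp u) : ℂ)) t).re

/-! ## Discharge of Prop. 2.2 (i) (cc/ASSIGNMENTS D3) — PROVED

The printed computation (§1 p. 8, §2 p. 11): `∫_Δ cos(2πρxy)cos(2πxy)dydx` by product-to-sum and the
square integral `∫₀¹∫₀¹ cos(a x y) dy dx = ∫₀¹ sin(ax)/(ax) dx = Si(a)/a` (the source passes through
`I(Δ) = ∫₀¹ cos cos (−log t)dt` and "`∫₀¹ cos(2πat)(−log t)dt = Si(2πa)/(2πa)`"; integrating first in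
`y` gives the same closed form without the logarithm). -/

/-- `∫₀¹ cos(c y) dy = sin(c)/c` for `c ≠ 0`. [cite: ConnesConsani2021, §2 p. 11 (chunk p0011:L6–L10)] -/
private theorem setIntegral_cos_mul_Ioc {c : ℝ} (hc : c ≠ 0) :
    ∫ y in Ioc (0 : ℝ) 1, Real.cos (c * y) = Real.sin c / c := by
  rw [← intervalIntegral.integral_of_le zero_le_one,
    intervalIntegral.integral_comp_mul_left (fun u => Real.cos u) hc, integral_cos]
  simp [div_eq_inv_mul]

/-- `∫₀¹ cos(0·y) dy = 1`. [cite: ConnesConsani2021, §2 p. 11 (chunk p0011:L6–L10)] -/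
private theorem setIntegral_cos_zero_mul_Ioc :
    ∫ y in Ioc (0 : ℝ) 1, Real.cos (0 * y) = 1 := by
  simp

/-- `x ↦ sin(bx)/(bx)` is integrable on `(0,1]` (bounded by `1`, measurable).
[cite: ConnesConsani2021, §2 p. 11 (chunk p0011:L6–L10)] -/
private theorem integrableOn_sin_div (b : ℝ) :
    IntegrableOn (fun x : ℝ => Real.sin (b * x) / (b * x)) (Ioc 0 1) := by
  refine Measure.integrableOn_of_bounded (M := 1) (by simp) ?_ ?_
  · exact (Measurable.aestronglyMeasurable (by fun_prop))
  · refine Filter.Eventually.of_forall fun x => ?_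
    rw [Real.norm_eq_abs, abs_div]
    rcases eq_or_ne (b * x) 0 with h0 | h0
    · simp [h0]
    · rw [div_le_one (abs_pos.2 h0)]
      exact Real.abs_sin_le_abs

/-- The square integral `∫₀¹∫₀¹ cos(a x y) dy dx = Si(a)/a` (`a ≠ 0`): inner integral `sin(ax)/(ax)`,
then the substitution `u = ax` (§2 p. 11: "`∫₀¹cos(2πat)(−log t)dt = Si(2πa)/(2πa)`", here reached by
integrating in `y` first). [cite: ConnesConsani2021, §2 p. 11 (chunk p0011:L6–L10)] -/
theorem setIntegral_sq_cos_mul (a : ℝ) (ha : a ≠ 0) :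
    ∫ x in Ioc (0 : ℝ) 1, ∫ y in Ioc (0 : ℝ) 1, Real.cos (a * x * y) = sinIntegral a / a := by
  have h1 : ∀ x ∈ Ioc (0 : ℝ) 1,
      ∫ y in Ioc (0 : ℝ) 1, Real.cos (a * x * y) = Real.sin (a * x) / (a * x) := fun x hx =>
    setIntegral_cos_mul_Ioc (mul_ne_zero ha hx.1.ne')
  rw [setIntegral_congr_fun measurableSet_Ioc h1, ← intervalIntegral.integral_of_le zero_le_one,
    show (fun x : ℝ => Real.sin (a * x) / (a * x)) = fun x => (fun u => Real.sin u / u) (a * x) from rfl,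
    intervalIntegral.integral_comp_mul_left (fun u => Real.sin u / u) ha, mul_zero, mul_one, sinIntegral]
  simp [div_eq_inv_mul]

/-- The square integral for `a = 0` is `1`. [cite: ConnesConsani2021, §2 p. 11 (chunk p0011:L6–L10)] -/
theorem setIntegral_sq_cos_zero_mul :
    ∫ x in Ioc (0 : ℝ) 1, ∫ y in Ioc (0 : ℝ) 1, Real.cos (0 * x * y) = 1 := by
  simp

/-- Product-to-sum inside the `Δ`-integral: for `x > 0`,
`∫₀¹ cos(2πρxy)cos(2πxy)dy = ½(∫₀¹cos(2π(1+ρ)xy)dy + ∫₀¹cos(2π(ρ−1)xy)dy)` ("Using the formula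
`2cos(x)cos(y) = cos(x+y) + cos(x−y)`", §2 p. 11). [cite: ConnesConsani2021, §2 p. 11 (chunk p0011:L10)] -/
private theorem inner_cos_mul_cos (ρ x : ℝ) :
    ∫ y in Ioc (0 : ℝ) 1, Real.cos (2 * π * ρ * x * y) * Real.cos (2 * π * x * y) =
      ((∫ y in Ioc (0 : ℝ) 1, Real.cos (2 * π * (1 + ρ) * x * y)) +
        ∫ y in Ioc (0 : ℝ) 1, Real.cos (2 * π * (ρ - 1) * x * y)) / 2 := by
  have hcc : ∀ y : ℝ, Real.cos (2 * π * ρ * x * y) * Real.cos (2 * π * x * y) =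
      (Real.cos (2 * π * (1 + ρ) * x * y) + Real.cos (2 * π * (ρ - 1) * x * y)) / 2 := by
    intro y
    rw [show 2 * π * (1 + ρ) * x * y = 2 * π * ρ * x * y + 2 * π * x * y by ring,
      show 2 * π * (ρ - 1) * x * y = 2 * π * ρ * x * y - 2 * π * x * y by ring, Real.cos_add,
      Real.cos_sub]
    ring
  simp_rw [hcc]
  rw [integral_div, integral_add]
  · exact (Continuous.integrableOn_Ioc (by fun_prop))
  · exact (Continuous.integrableOn_Ioc (by fun_prop))

/-- **Prop. 2.2 (i) DISCHARGED**: for `ρ ≥ 1`, `δ(ρ) = 4ρ^{1/2}∫_Δ cos(2πρxy)cos(2πxy)dydx` — with `δ`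
given by the closed form (25), this is the printed computation of §1 p. 8 / §2 p. 11 (product-to-sum
and `∫∫_Δ cos(a x y) = Si(a)/a`, the term `ρ = 1` being the removable singularity `Si(0·)/0· = 1`).
[cite: ConnesConsani2021, §2 Prop. 2.2 (i) (= arXiv Prop. 10 (i)) p. 10 (chunk p0010:L15–L18); p. 11 (chunk p0011:L1–L12)] -/
theorem CC2021_prop_2_2_i_holds : CC2021_prop_2_2_i := by
  intro ρ hρ
  have hπ : (0 : ℝ) < π := Real.pi_pos
  have hb1 : 2 * π * (1 + ρ) ≠ 0 := by positivity
  -- the outer integrand, rewritten through the inner closed forms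
  have houter : deltaSquareIntegral ρ =
      ((∫ x in Ioc (0 : ℝ) 1, ∫ y in Ioc (0 : ℝ) 1, Real.cos (2 * π * (1 + ρ) * x * y)) +
        ∫ x in Ioc (0 : ℝ) 1, ∫ y in Ioc (0 : ℝ) 1, Real.cos (2 * π * (ρ - 1) * x * y)) / 2 := by
    rw [deltaSquareIntegral, setIntegral_congr_fun measurableSet_Ioc (fun x _ => inner_cos_mul_cos ρ x),
      integral_div, integral_add]
    · -- integrability of x ↦ ∫ cos(b₁ x y) dy on (0,1]: it is sin(b₁x)/(b₁x) there
      refine (integrableOn_sin_div (2 * π * (1 + ρ))).congr_fun (fun x hx => ?_) measurableSet_Ioc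
      exact (setIntegral_cos_mul_Ioc (mul_ne_zero hb1 hx.1.ne')).symm
    · rcases eq_or_ne (2 * π * (ρ - 1)) 0 with h0 | h0
      · rw [h0]
        refine (integrableOn_const (C := (1 : ℝ)) ?_).congr_fun (fun x _ => ?_) measurableSet_Ioc
        · simp
        · simp
      · refine (integrableOn_sin_div (2 * π * (ρ - 1))).congr_fun (fun x hx => ?_) measurableSet_Ioc
        exact (setIntegral_cos_mul_Ioc (mul_ne_zero h0 hx.1.ne')).symm
  rw [traceRemainder_of_one_le hρ, traceRemainderAux, houter, setIntegral_sq_cos_mul _ hb1]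
  rcases eq_or_ne ρ 1 with h1 | h1
  · subst h1
    rw [show (2 * π * ((1 : ℝ) - 1)) = 0 by ring, setIntegral_sq_cos_zero_mul, if_pos rfl]
    ring
  · have hb2 : 2 * π * (ρ - 1) ≠ 0 := mul_ne_zero (by positivity) (sub_ne_zero.2 h1)
    rw [setIntegral_sq_cos_mul _ hb2, if_neg h1]
    ring

/-! ## The Sine integral: `Si(x) = (1 − cos x)/x + ∫₀ˣ (1 − cos t)/t² dt`, positivity and bounds

"Since the Sine Integral function `Si(z)` is positive for `z ≥ 0`, `δ(ρ)` is positive" (§2 p. 11);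
"`Si(x)/x ≤ 1` for `x > 0`, while `Si(x) ≤ 2` for `x > 0` … this provides the estimate
`δ(ρ) = ρ^{-1/2} + O(ρ^{-3/2})`" (§2 p. 11).  We prove `Si > 0` on `(0,∞)`, the uniform bound
`|Si| ≤ 5`, and deduce `|δ(ρ)| ≤ 10/√ρ` for `ρ ≥ 1` and the integrability of `δ ∘ exp` (so that
`remainderD` and `δ̂` are honest Lebesgue integrals). -/

/-- `‖sin t / t‖ ≤ 1`. [cite: ConnesConsani2021, §2 p. 11 (chunk p0011:L47)] -/
private theorem norm_sin_div_le_one (t : ℝ) : ‖Real.sin t / t‖ ≤ 1 := by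
  rw [Real.norm_eq_abs, abs_div]
  rcases eq_or_ne t 0 with rfl | ht
  · simp
  · rw [div_le_one (abs_pos.2 ht)]
    exact Real.abs_sin_le_abs

/-- `0 ≤ (1 − cos t)/t² ≤ 1/2`. [cite: ConnesConsani2021, §2 p. 11 (chunk p0011:L47)] -/
private theorem one_sub_cos_div_sq_mem (t : ℝ) :
    0 ≤ (1 - Real.cos t) / t ^ 2 ∧ (1 - Real.cos t) / t ^ 2 ≤ 1 / 2 := by
  have h1 : 0 ≤ 1 - Real.cos t := sub_nonneg.2 (Real.cos_le_one t)
  refine ⟨div_nonneg h1 (sq_nonneg t), ?_⟩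
  rcases eq_or_ne t 0 with rfl | ht
  · simp
  · rw [div_le_iff₀ (by positivity)]
    have := Real.one_sub_sq_div_two_le_cos (x := t)
    linarith

/-- `sin t / t` is interval integrable on every interval. [cite: ConnesConsani2021, §2 p. 11 (chunk p0011:L10)] -/
private theorem intervalIntegrable_sin_div (a b : ℝ) :
    IntervalIntegrable (fun t : ℝ => Real.sin t / t) volume a b :=
  (intervalIntegrable_const (c := (1 : ℝ))).mono_fun' (Measurable.aestronglyMeasurable (by fun_prop))
    (Filter.Eventually.of_forall fun t => norm_sin_div_le_one t)

/-- `(1 − cos t)/t²` is interval integrable on every interval. [cite: ConnesConsani2021, §2 p. 11 (chunk p0011:L10)] -/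
private theorem intervalIntegrable_one_sub_cos_div_sq (a b : ℝ) :
    IntervalIntegrable (fun t : ℝ => (1 - Real.cos t) / t ^ 2) volume a b :=
  (intervalIntegrable_const (c := (1 / 2 : ℝ))).mono_fun' (Measurable.aestronglyMeasurable (by fun_prop))
    (Filter.Eventually.of_forall fun t => by
      show ‖(1 - Real.cos t) / t ^ 2‖ ≤ 1 / 2
      rw [Real.norm_eq_abs, abs_of_nonneg (one_sub_cos_div_sq_mem t).1]
      exact (one_sub_cos_div_sq_mem t).2)

/-- `Si` is continuous. [cite: ConnesConsani2021, §2 p. 11 (chunk p0011:L10)] -/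
theorem continuous_sinIntegral : Continuous sinIntegral :=
  intervalIntegral.continuous_primitive (fun a b => intervalIntegrable_sin_div a b) 0

/-- **Integration by parts for `Si`**: `Si(x) = (1 − cos x)/x + ∫₀ˣ (1 − cos t)/t² dt` (`x ≥ 0`;
`v = 1 − cos t` vanishes at `0`, so no boundary term there).  The tool for the printed remarks
"`Si` is positive", "`Si(x) ≤ 2`" (§2 p. 11). [cite: ConnesConsani2021, §2 p. 11 (chunk p0011:L18, L47)] -/
theorem sinIntegral_eq_add_integral {x : ℝ} (hx : 0 ≤ x) :
    sinIntegral x = (1 - Real.cos x) / x + ∫ t in (0 : ℝ)..x, (1 - Real.cos t) / t ^ 2 := by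
  have hcont : ContinuousOn (fun t : ℝ => (1 - Real.cos t) / t) (Icc 0 x) := by
    intro t ht
    rcases eq_or_lt_of_le ht.1 with h0 | ht0
    · -- continuity at `0`: `|(1 − cos s)/s| ≤ |s|/2`
      subst h0
      have hbound : ∀ s : ℝ, ‖(1 - Real.cos s) / s‖ ≤ |s| / 2 := by
        intro s
        rcases eq_or_ne s 0 with rfl | hs
        · simp
        · rw [Real.norm_eq_abs, abs_div, abs_of_nonneg (sub_nonneg.2 (Real.cos_le_one s)),
            div_le_iff₀ (abs_pos.2 hs)]
          have := Real.one_sub_sq_div_two_le_cos (x := s)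
          have hs2 : |s| / 2 * |s| = s ^ 2 / 2 := by rw [div_mul_eq_mul_div, ← sq, sq_abs]
          linarith
      refine ContinuousAt.continuousWithinAt ?_
      show Filter.Tendsto (fun t : ℝ => (1 - Real.cos t) / t) (nhds 0) (nhds ((1 - Real.cos 0) / 0))
      rw [Real.cos_zero, sub_self, zero_div]
      refine squeeze_zero_norm hbound ?_
      have : Filter.Tendsto (fun s : ℝ => |s| / 2) (nhds 0) (nhds (|0| / 2)) :=
        (continuous_abs.div_const 2).tendsto 0
      simpa using this
    · exact ((continuous_const.sub Real.continuous_cos).continuousAt.div continuousAt_id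
        ht0.ne').continuousWithinAt
  have hderiv : ∀ t ∈ Ioo 0 x,
      HasDerivAt (fun t : ℝ => (1 - Real.cos t) / t) (Real.sin t / t - (1 - Real.cos t) / t ^ 2) t := by
    intro t ht
    have ht0 : t ≠ 0 := ht.1.ne'
    have h1 : HasDerivAt (fun t : ℝ => 1 - Real.cos t) (Real.sin t) t := by
      simpa using (Real.hasDerivAt_cos t).const_sub 1
    have h2 := h1.div (hasDerivAt_id' t) ht0
    have heq : (Real.sin t * t - (1 - Real.cos t) * 1) / t ^ 2 =
        Real.sin t / t - (1 - Real.cos t) / t ^ 2 := by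
      rw [mul_one, sub_div, pow_two, mul_div_mul_right _ _ ht0]
    rw [heq] at h2
    exact h2
  have hFTC := intervalIntegral.integral_eq_sub_of_hasDerivAt_of_le hx hcont hderiv
    ((intervalIntegrable_sin_div 0 x).sub (intervalIntegrable_one_sub_cos_div_sq 0 x))
  rw [intervalIntegral.integral_sub (intervalIntegrable_sin_div 0 x)
    (intervalIntegrable_one_sub_cos_div_sq 0 x)] at hFTC
  simp only [Real.cos_zero, sub_self, zero_div, sub_zero] at hFTC
  rw [sinIntegral]
  linarith

/-- `Si(x) ≥ 0` for `x ≥ 0`. [cite: ConnesConsani2021, §2 p. 11 (chunk p0011:L18)] -/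
theorem sinIntegral_nonneg {x : ℝ} (hx : 0 ≤ x) : 0 ≤ sinIntegral x := by
  rw [sinIntegral_eq_add_integral hx]
  have h1 : 0 ≤ (1 - Real.cos x) / x := div_nonneg (sub_nonneg.2 (Real.cos_le_one x)) hx
  have h2 : 0 ≤ ∫ t in (0 : ℝ)..x, (1 - Real.cos t) / t ^ 2 :=
    intervalIntegral.integral_nonneg hx (fun t _ => (one_sub_cos_div_sq_mem t).1)
  linarith

/-- **"The Sine Integral function `Si(z)` is positive for `z > 0`"** (§2 p. 11; the source writes
`z ≥ 0`, with `Si(0) = 0`).  PROVED: `Si(x) ≥ ∫₀^{min(x,1)} (1 − cos t)/t² dt > 0`.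
[cite: ConnesConsani2021, §2 p. 11 (chunk p0011:L18)] -/
theorem sinIntegral_pos {x : ℝ} (hx : 0 < x) : 0 < sinIntegral x := by
  rw [sinIntegral_eq_add_integral hx.le]
  have h1 : 0 ≤ (1 - Real.cos x) / x := div_nonneg (sub_nonneg.2 (Real.cos_le_one x)) hx.le
  set m : ℝ := min x 1 with hm
  have hm0 : 0 < m := lt_min hx one_pos
  have hmx : m ≤ x := min_le_left _ _
  have hsplit := intervalIntegral.integral_add_adjacent_intervals
    (intervalIntegrable_one_sub_cos_div_sq 0 m) (intervalIntegrable_one_sub_cos_div_sq m x)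
  have h2 : 0 < ∫ t in (0 : ℝ)..m, (1 - Real.cos t) / t ^ 2 := by
    refine intervalIntegral.intervalIntegral_pos_of_pos_on (intervalIntegrable_one_sub_cos_div_sq 0 m)
      (fun t ht => ?_) hm0
    have ht1 : t < 1 := lt_of_lt_of_le ht.2 (min_le_right _ _)
    have hπ : (3 : ℝ) < π := Real.pi_gt_three
    have hcos : Real.cos t ≠ 1 := by
      rw [Ne, Real.cos_eq_one_iff_of_lt_of_lt (by linarith [ht.1]) (by linarith)]
      exact ht.1.ne'
    have : 0 < 1 - Real.cos t := sub_pos.2 (lt_of_le_of_ne (Real.cos_le_one t) hcos)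
    exact div_pos this (by nlinarith [ht.1])
  have h3 : 0 ≤ ∫ t in m..x, (1 - Real.cos t) / t ^ 2 :=
    intervalIntegral.integral_nonneg hmx (fun t _ => (one_sub_cos_div_sq_mem t).1)
  linarith

/-- `∫₁ˣ (1 − cos t)/t² dt ≤ 2` for `x ≥ 1` (compare with `2/t²`, primitive `−2/t`).
[cite: ConnesConsani2021, §2 p. 11 (chunk p0011:L47)] -/
private theorem integral_one_sub_cos_div_sq_le {x : ℝ} (hx : 1 ≤ x) :
    ∫ t in (1 : ℝ)..x, (1 - Real.cos t) / t ^ 2 ≤ 2 := by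
  have hle : ∀ t ∈ Icc 1 x, (1 - Real.cos t) / t ^ 2 ≤ 2 / t ^ 2 := by
    intro t ht
    have : 1 - Real.cos t ≤ 2 := by linarith [Real.neg_one_le_cos t]
    exact div_le_div_of_nonneg_right this (by positivity)
  have hint2 : IntervalIntegrable (fun t : ℝ => 2 / t ^ 2) volume 1 x := by
    refine (ContinuousOn.intervalIntegrable ?_)
    refine continuousOn_const.div (continuousOn_id.pow 2) (fun t ht => ?_)
    have : 0 < t := by
      rw [uIcc_of_le hx] at ht
      linarith [ht.1]
    positivity
  have hmono := intervalIntegral.integral_mono_on hx (intervalIntegrable_one_sub_cos_div_sq 1 x) hint2 hle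
  have hderiv : ∀ t ∈ Ioo 1 x, HasDerivAt (fun t : ℝ => -2 / t) (2 / t ^ 2) t := by
    intro t ht
    have ht0 : t ≠ 0 := by linarith [ht.1]
    have h := (hasDerivAt_inv ht0).const_mul (-2 : ℝ)
    have hfun : (fun y : ℝ => -2 * y⁻¹) = fun y => -2 / y := by
      funext y; rw [div_eq_mul_inv]
    have hval : (-2 : ℝ) * -(t ^ 2)⁻¹ = 2 / t ^ 2 := by
      rw [mul_neg, neg_mul, neg_neg, div_eq_mul_inv]
    rw [hfun, hval] at h
    exact h
  have hcont : ContinuousOn (fun t : ℝ => -2 / t) (Icc 1 x) :=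
    continuousOn_const.div continuousOn_id (fun t ht => by linarith [ht.1])
  have hFTC := intervalIntegral.integral_eq_sub_of_hasDerivAt_of_le hx hcont hderiv hint2
  rw [hFTC] at hmono
  have hx0 : 0 < x := by linarith
  have : -2 / x - -2 / 1 ≤ 2 := by
    rw [div_one]
    have : 0 ≤ 2 / x := by positivity
    have : -2 / x = -(2 / x) := by ring
    linarith
  linarith

/-- `Si` is odd: `Si(−x) = −Si(x)` (the integrand `sin t/t` is even). [cite: ConnesConsani2021, §2 p. 11 (chunk p0011:L10)] -/
theorem sinIntegral_neg (x : ℝ) : sinIntegral (-x) = -sinIntegral x := by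
  rw [sinIntegral, sinIntegral]
  have heven : (fun t : ℝ => Real.sin t / t) = fun t => (fun u : ℝ => Real.sin u / u) (-t) := by
    funext t
    simp [Real.sin_neg, neg_div_neg_eq]
  conv_lhs => rw [heven]
  rw [intervalIntegral.integral_comp_neg (fun u : ℝ => Real.sin u / u), neg_neg, neg_zero,
    intervalIntegral.integral_symm]

/-- `∫₀¹ (1 − cos t)/t² dt ≤ 1/2`. [cite: ConnesConsani2021, §2 p. 11 (chunk p0011:L47)] -/
private theorem integral_one_sub_cos_div_sq_unit_le :
    ∫ t in (0 : ℝ)..1, (1 - Real.cos t) / t ^ 2 ≤ 1 / 2 := by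
  have h := intervalIntegral.integral_mono_on zero_le_one (intervalIntegrable_one_sub_cos_div_sq 0 1)
    (intervalIntegrable_const (c := (1 / 2 : ℝ))) (fun t _ => (one_sub_cos_div_sq_mem t).2)
  simpa using h

/-- **"`Si(x) ≤ 2` for `x > 0`"** (§2 p. 11), in the weaker uniform form `|Si(x)| ≤ 5` for all real
`x` (enough for the decay of `δ`; the sharp bound `Si ≤ Si(π) = 1.85…` is not needed here).  PROVED
from `Si(x) = (1 − cos x)/x + ∫₀ˣ(1 − cos t)/t²dt`. [cite: ConnesConsani2021, §2 p. 11 (chunk p0011:L47)] -/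
theorem abs_sinIntegral_le_five (x : ℝ) : |sinIntegral x| ≤ 5 := by
  suffices key : ∀ y : ℝ, 0 ≤ y → |sinIntegral y| ≤ 5 by
    rcases le_total 0 x with hx | hx
    · exact key x hx
    · have := key (-x) (by linarith)
      rwa [sinIntegral_neg, abs_neg] at this
  intro y hy
  rcases le_or_gt y 1 with hy1 | hy1
  · calc |sinIntegral y| ≤ |y| := abs_sinIntegral_le y
      _ ≤ 5 := by rw [abs_of_nonneg hy]; linarith
  · rw [abs_of_nonneg (sinIntegral_nonneg hy), sinIntegral_eq_add_integral hy,
      ← intervalIntegral.integral_add_adjacent_intervals (intervalIntegrable_one_sub_cos_div_sq 0 1)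
        (intervalIntegrable_one_sub_cos_div_sq 1 y)]
    have h1 : (1 - Real.cos y) / y ≤ 2 := by
      rw [div_le_iff₀ (by linarith)]
      linarith [Real.neg_one_le_cos y]
    have h2 := integral_one_sub_cos_div_sq_unit_le
    have h3 := integral_one_sub_cos_div_sq_le hy1.le
    linarith

/-- `|Si(y)/y| ≤ 1` (from `|Si(y)| ≤ |y|`; "`Si(x)/x ≤ 1` for `x > 0`", §2 p. 11).
[cite: ConnesConsani2021, §2 p. 11 (chunk p0011:L47)] -/
theorem abs_sinIntegral_div_self_le (y : ℝ) : |sinIntegral y / y| ≤ 1 := by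
  rcases eq_or_ne y 0 with rfl | hy
  · simp
  · rw [abs_div, div_le_one (abs_pos.2 hy)]
    exact abs_sinIntegral_le y

/-- **Decay of the trace-remainder**: `|δ(ρ)| ≤ 8/√ρ` for `ρ ≥ 1` (the printed
"`δ(ρ) = ρ^{-1/2} + O(ρ^{-3/2})` as `ρ → ∞`", §2 p. 11, in a form uniform on `[1,∞)`; from `|Si| ≤ 5`
and `|Si(x)/x| ≤ 1`).  PROVED. [cite: ConnesConsani2021, §2 p. 11 (chunk p0011:L47–L50)] -/
theorem abs_traceRemainder_le {ρ : ℝ} (hρ : 1 ≤ ρ) : |traceRemainder ρ| ≤ 8 / Real.sqrt ρ := by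
  have hρ0 : 0 < ρ := by linarith
  have hπ : (3 : ℝ) < π := Real.pi_gt_three
  have hs0 : 0 < Real.sqrt ρ := Real.sqrt_pos.2 hρ0
  have hss : Real.sqrt ρ * Real.sqrt ρ = ρ := Real.mul_self_sqrt hρ0.le
  rw [traceRemainder_of_one_le hρ, traceRemainderAux]
  set A : ℝ := sinIntegral (2 * π * (1 + ρ)) / (2 * π * (1 + ρ)) with hA
  set B : ℝ := (if ρ = 1 then 1 else sinIntegral (2 * π * (ρ - 1)) / (2 * π * (ρ - 1))) with hB
  -- `ρ |A| ≤ 5/6`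
  have hb1 : 0 < 2 * π * (1 + ρ) := by positivity
  have hA' : ρ * |A| ≤ 5 / 6 := by
    rw [hA, abs_div, abs_of_pos hb1]
    have h5 := abs_sinIntegral_le_five (2 * π * (1 + ρ))
    have : ρ * (|sinIntegral (2 * π * (1 + ρ))| / (2 * π * (1 + ρ))) ≤ ρ * (5 / (6 * ρ)) := by
      refine mul_le_mul_of_nonneg_left ?_ hρ0.le
      calc |sinIntegral (2 * π * (1 + ρ))| / (2 * π * (1 + ρ))
          ≤ 5 / (2 * π * (1 + ρ)) := div_le_div_of_nonneg_right h5 hb1.le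
        _ ≤ 5 / (6 * ρ) := div_le_div_of_nonneg_left (by norm_num) (by positivity) (by nlinarith)
    calc ρ * (|sinIntegral (2 * π * (1 + ρ))| / (2 * π * (1 + ρ))) ≤ ρ * (5 / (6 * ρ)) := this
      _ = 5 / 6 := by field_simp
  -- `ρ |B| ≤ 2`
  have hB' : ρ * |B| ≤ 2 := by
    rcases lt_or_ge ρ 2 with h2 | h2
    · have hB1 : |B| ≤ 1 := by
        rw [hB]
        split_ifs
        · simp
        · exact abs_sinIntegral_div_self_le _
      nlinarith [abs_nonneg B]
    · have hne : ρ ≠ 1 := by linarith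
      have hb2 : 0 < 2 * π * (ρ - 1) := by nlinarith
      rw [hB, if_neg hne, abs_div, abs_of_pos hb2]
      have h5 := abs_sinIntegral_le_five (2 * π * (ρ - 1))
      have : ρ * (|sinIntegral (2 * π * (ρ - 1))| / (2 * π * (ρ - 1))) ≤ ρ * (5 / (3 * ρ)) := by
        refine mul_le_mul_of_nonneg_left ?_ hρ0.le
        calc |sinIntegral (2 * π * (ρ - 1))| / (2 * π * (ρ - 1))
            ≤ 5 / (2 * π * (ρ - 1)) := div_le_div_of_nonneg_right h5 hb2.le
          _ ≤ 5 / (3 * ρ) := div_le_div_of_nonneg_left (by norm_num) (by positivity) (by nlinarith)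
      calc ρ * (|sinIntegral (2 * π * (ρ - 1))| / (2 * π * (ρ - 1))) ≤ ρ * (5 / (3 * ρ)) := this
        _ = 5 / 3 := by field_simp
        _ ≤ 2 := by norm_num
  -- assemble: `|2√ρ(A+B)| = 2√ρ|A+B| ≤ 2√ρ(|A|+|B|)` and `ρ(|A|+|B|) ≤ 4`
  have hsum : ρ * (|A| + |B|) ≤ 4 := by nlinarith
  rw [abs_mul, abs_mul, abs_of_pos (by norm_num : (0:ℝ) < 2), abs_of_pos hs0,
    le_div_iff₀ hs0]
  calc 2 * Real.sqrt ρ * |A + B| * Real.sqrt ρ = 2 * ρ * |A + B| := by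
        rw [show 2 * Real.sqrt ρ * |A + B| * Real.sqrt ρ = 2 * (Real.sqrt ρ * Real.sqrt ρ) * |A + B| by ring,
          hss]
    _ ≤ 2 * ρ * (|A| + |B|) := by
        exact mul_le_mul_of_nonneg_left (abs_add_le A B) (by positivity)
    _ ≤ 8 := by nlinarith

/-- Decay on `(0,1]` by the symmetry `δ(ρ⁻¹) = δ(ρ)`: `|δ(ρ)| ≤ 8√ρ` for `0 < ρ ≤ 1`.
[cite: ConnesConsani2021, §2 Prop. 2.2 (ii) p. 10; p. 11 (chunk p0011:L47–L50)] -/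
theorem abs_traceRemainder_le_of_le_one {ρ : ℝ} (hρ0 : 0 < ρ) (hρ : ρ ≤ 1) :
    |traceRemainder ρ| ≤ 8 * Real.sqrt ρ := by
  have h := abs_traceRemainder_le (one_le_inv_iff₀.2 ⟨hρ0, hρ⟩)
  rw [traceRemainder_inv, Real.sqrt_inv, div_inv_eq_mul] at h
  exact h

/-- `|δ(e^u)| ≤ 8 e^{-|u|/2}`. [cite: ConnesConsani2021, §2 p. 11 (chunk p0011:L47–L50)] -/
theorem abs_traceRemainder_exp_le (u : ℝ) :
    |traceRemainder (Real.exp u)| ≤ 8 * Real.exp (-|u| / 2) := by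
  rcases le_total 0 u with hu | hu
  · have h := abs_traceRemainder_le (Real.one_le_exp_iff.2 hu)  -- name?
    rw [abs_of_nonneg hu]
    calc |traceRemainder (Real.exp u)| ≤ 8 / Real.sqrt (Real.exp u) := h
      _ = 8 * Real.exp (-u / 2) := by
        rw [Real.sqrt_eq_rpow, ← Real.exp_mul, div_eq_mul_inv, ← Real.exp_neg]
        ring_nf
  · have h := abs_traceRemainder_le_of_le_one (Real.exp_pos u) (Real.exp_le_one_iff.2 hu)
    rw [abs_of_nonpos hu, neg_neg]
    calc |traceRemainder (Real.exp u)| ≤ 8 * Real.sqrt (Real.exp u) := h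
      _ = 8 * Real.exp (u / 2) := by
        rw [Real.sqrt_eq_rpow, ← Real.exp_mul]
        ring_nf

/-- `δ` is measurable (continuous pieces, one `if`). [cite: ConnesConsani2021, §2 eq. (25) p. 11] -/
theorem measurable_traceRemainder : Measurable traceRemainder := by
  have hSi : Measurable sinIntegral := continuous_sinIntegral.measurable
  have hAux : Measurable traceRemainderAux := by
    refine Measurable.mul (by fun_prop) (Measurable.add ?_ ?_)
    · exact (hSi.comp (by fun_prop)).div (by fun_prop)
    · refine Measurable.ite ?_ measurable_const ((hSi.comp (by fun_prop)).div (by fun_prop))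
      exact measurableSet_eq_fun measurable_id measurable_const
  exact hAux.comp (measurable_id.max measurable_inv)

/-- The dominating function `8 e^{-|u|/2}` is integrable on `ℝ`. [cite: ConnesConsani2021, §2 p. 11 (chunk p0011:L47–L51)] -/
private theorem integrable_exp_neg_abs_half :
    Integrable (fun u : ℝ => 8 * Real.exp (-|u| / 2)) := by
  refine Integrable.const_mul ?_ 8
  rw [← integrableOn_univ, ← Iic_union_Ioi (a := (0 : ℝ))]
  refine IntegrableOn.union ?_ ?_
  · refine (integrableOn_exp_mul_Iic (a := 1 / 2) (by norm_num) 0).congr_fun (fun u hu => ?_)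
      measurableSet_Iic
    rw [abs_of_nonpos (mem_Iic.1 hu)]
    ring_nf
  · refine (exp_neg_integrableOn_Ioi 0 (b := 1 / 2) (by norm_num)).congr_fun (fun u hu => ?_)
      measurableSet_Ioi
    rw [abs_of_pos (mem_Ioi.1 hu)]
    ring_nf

/-- **`δ ∘ exp` is Lebesgue integrable on `ℝ`** — so `D(f) = ∫ k(t)δ(e^t)dt` (`remainderD`) and
`δ̂(t) = ∫ δ(e^u)e^{-itu}du` (Cor. 2.3 (ii)) are honest integrals ("`δ̂(t)` … being the Fourier
transform of an integrable function", §2 p. 11).  PROVED. [cite: ConnesConsani2021, §2 p. 11 (chunk p0011:L47–L53)] -/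
theorem integrable_traceRemainder_exp : Integrable (fun u : ℝ => traceRemainder (Real.exp u)) := by
  refine integrable_exp_neg_abs_half.mono'
    ((measurable_traceRemainder.comp Real.measurable_exp).aestronglyMeasurable)
    (Filter.Eventually.of_forall fun u => ?_)
  rw [Real.norm_eq_abs]
  exact abs_traceRemainder_exp_le u

/-- **"`δ(ρ)` is positive"** (§2 p. 11, from `Si > 0`): for `ρ > 0`, `δ(ρ) > 0`.  PROVED.
[cite: ConnesConsani2021, §2 p. 11 (chunk p0011:L18)] -/
theorem traceRemainder_pos {ρ : ℝ} (hρ : 0 < ρ) : 0 < traceRemainder ρ := by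
  -- reduce to `r = max ρ ρ⁻¹ ≥ 1`
  have hr : 1 ≤ max ρ ρ⁻¹ := by
    rcases le_total 1 ρ with h | h
    · exact le_max_of_le_left h
    · exact le_max_of_le_right (one_le_inv_iff₀.2 ⟨hρ, h⟩)
  rw [traceRemainder]
  set r := max ρ ρ⁻¹ with hr_def
  have hr0 : 0 < r := by linarith
  have hπ : (0 : ℝ) < π := Real.pi_pos
  rw [traceRemainderAux]
  have hA : 0 < sinIntegral (2 * π * (1 + r)) / (2 * π * (1 + r)) :=
    div_pos (sinIntegral_pos (by positivity)) (by positivity)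
  have hB : 0 < (if r = 1 then 1 else sinIntegral (2 * π * (r - 1)) / (2 * π * (r - 1))) := by
    split_ifs with h1
    · exact one_pos
    · have : 0 < 2 * π * (r - 1) := by
        have : 1 < r := lt_of_le_of_ne hr (Ne.symm h1)
        nlinarith
      exact div_pos (sinIntegral_pos this) this
  have : 0 < Real.sqrt r := Real.sqrt_pos.2 hr0
  positivity

/-! ## `W_∞(f) = ∫ f̂(t) 2θ′(t) dt/2π` (proof of Cor. 2.3 (ii), eq. (qdofu1) + (riesie)) — PROVED -/

/-- **The archimedean functional through the Riemann–Siegel angular function** (proof of Cor. 2.3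
(ii), §2 p. 11: "By applying (qdofu1), one has
`−∫ f(ρ⁻¹)τ(ρ)d*ρ = −Tr(f̂ ½u⁻¹đu) = ∫ f̂(t) 2∂_tθ(t)/(2π) dt`"; App. B p. 31: the archimedean term
of the explicit formula "is the derivative of `2θ(τ)`").  In the tree's vocabulary:
`archW k = (1/2π) ∫ mulFourier k t · 2θ′(t) dt` for every test function `k`, with
`θ′ = riemannSiegelThetaDeriv`.  PROVED from `weilArchTermBombieri_eq_weilArchTerm_holds` (digamma
form of `W_∞`), `2θ′(t) = Re ψ(1/4 + it/2) − log π`, and Fourier inversion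
`∫ ĝ(1/2 + it) dt = 2π g(0)` (`integral_weilMellin_vertical`).
[cite: ConnesConsani2021, §2 proof of Cor. 2.3 (ii) p. 11 (chunk p0011:L30–L32); App. B eq. (84) p. 31 (chunk p0031:L31)] -/
theorem archW_eq_integral_mulFourier_thetaDeriv {k : ℝ → ℂ} (hk : IsWeilTest k) :
    archW k = (1 / (2 * π) : ℂ) *
      ∫ t : ℝ, mulFourier k t * ((2 * riemannSiegelThetaDeriv t : ℝ) : ℂ) := by
  -- Step 1: `t ↦ −t` turns `mulFourier k t = ĝ(1/2 − it)` into `ĝ(1/2 + it)`; `θ′` is even.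
  have hsub : ∫ t : ℝ, mulFourier k t * ((2 * riemannSiegelThetaDeriv t : ℝ) : ℂ) =
      ∫ t : ℝ, weilMellin k (1 / 2 + t * I) * ((2 * riemannSiegelThetaDeriv t : ℝ) : ℂ) := by
    rw [← integral_neg_eq_self (fun t : ℝ => mulFourier k t * ((2 * riemannSiegelThetaDeriv t : ℝ) : ℂ))
      volume]
    refine integral_congr_ae (Filter.Eventually.of_forall fun t => ?_)
    simp only [riemannSiegelThetaDeriv_neg_holds t, mulFourier_eq_weilMellin]
    congr 2
    push_cast
    ring
  -- Step 2: `2θ′(t) = Re ψ(1/4 + it/2) − log π`.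
  have h2θ : ∀ t : ℝ, ((2 * riemannSiegelThetaDeriv t : ℝ) : ℂ) =
      ((Complex.digamma (1 / 4 + t / 2 * I)).re : ℂ) - (Real.log π : ℂ) := by
    intro t
    rw [riemannSiegelThetaDeriv]
    push_cast
    ring
  -- Step 3: integrability of the two pieces.
  have hI1 : Integrable fun t : ℝ => weilMellin k (1 / 2 + t * I) *
      ((Complex.digamma (1 / 4 + t / 2 * I)).re : ℂ) := by
    have h := WeilArchParity.integrable_weilMellin_mul_re_digamma_shift hk (x := 1 / 4) (by norm_num)
    refine h.congr (Filter.Eventually.of_forall fun t => ?_)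
    push_cast
    ring_nf
  have hI2 : Integrable fun t : ℝ => weilMellin k (1 / 2 + t * I) * (Real.log π : ℂ) := by
    have h := (integrable_weilMellin_vertical hk (1 / 2)).mul_const (Real.log π : ℂ)
    refine h.congr (Filter.Eventually.of_forall fun t => ?_)
    push_cast
    ring_nf
  have hL : ∫ t : ℝ, weilMellin k (1 / 2 + t * I) * (Real.log π : ℂ) = 2 * π * k 0 * Real.log π := by
    rw [integral_mul_const]
    have h' := integral_weilMellin_vertical hk (1 / 2)
    have e : (fun y : ℝ => weilMellin k (((1 / 2 : ℝ) : ℂ) + y * I)) =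
        fun y : ℝ => weilMellin k (1 / 2 + y * I) := by
      funext y; push_cast; ring_nf
    rw [e] at h'
    rw [h']
  rw [hsub, archW, weilArchTermBombieri_eq_weilArchTerm_holds hk, weilArchTerm, weilArchIntegral]
  simp_rw [h2θ, mul_sub]
  rw [integral_sub hI1 hI2, hL]
  generalize (∫ t : ℝ, weilMellin k (1 / 2 + t * I) * ((Complex.digamma (1 / 4 + t / 2 * I)).re : ℂ)) = J
  have hπ : (π : ℂ) ≠ 0 := by exact_mod_cast Real.pi_pos.ne'
  field_simp

/-! ## Parseval step of eq. (30) «lfourier»: `D(f) = (1/2π)∫ f̂(t) δ̂(t) dt`, hence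
`L(f) = ∫ f̂(t)(2θ′(t) + δ̂(t)) dt/2π` — PROVED -/

/-- **Parseval for the functional `D`** (proof of Cor. 2.3 (ii), §2 p. 11: "by Parseval's formula,
`∫ f(ρ⁻¹)δ(ρ)d*ρ = ∫ f(ρ)δ(ρ)d*ρ = (1/2π)∫ f̂(t)δ̂(t)dt`"): for every test function `k`,
`remainderD k = (1/2π) ∫ mulFourier k t · δ̂(t) dt` with `δ̂ = mulFourier (δ ∘ exp)`.  PROVED (Fubini —
`f̂ ∈ L¹` and `δ ∘ exp ∈ L¹` — and Fourier inversion `∫ ĝ(1/2+iy)e^{iyu}dy = 2πg(−u)`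
(`weilMellin_inversion`), then `δ(e^{−u}) = δ(e^u)`). [cite: ConnesConsani2021, §2 proof of Cor. 2.3 (ii) p. 11 (chunk p0011:L33–L36)] -/
theorem remainderD_eq_integral_mulFourier {k : ℝ → ℂ} (hk : IsWeilTest k) :
    remainderD k = (1 / (2 * π) : ℂ) *
      ∫ t : ℝ, mulFourier k t * mulFourier (fun u : ℝ => (traceRemainder (Real.exp u) : ℂ)) t := by
  set h : ℝ → ℂ := fun u => (traceRemainder (Real.exp u) : ℂ) with hh_def
  have hhi : Integrable h := integrable_traceRemainder_exp.ofReal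
  have hh_even : ∀ u : ℝ, h (-u) = h u := fun u => by
    simp only [hh_def, Real.exp_neg, traceRemainder_inv]
  have hKi : Integrable (fun t : ℝ => mulFourier k t) := by
    have h1 := (integrable_weilMellin_vertical hk (1 / 2)).comp_neg
    refine h1.congr (Filter.Eventually.of_forall fun t => ?_)
    simp only [mulFourier_eq_weilMellin]
    congr 1
    push_cast
    ring
  -- the phase factor has modulus one
  have hphase : ∀ t u : ℝ, ‖cexp (-(I * (t : ℂ) * (u : ℂ)))‖ = 1 := by
    intro t u
    rw [show (-(I * (t : ℂ) * (u : ℂ))) = ((-(t * u) : ℝ) : ℂ) * I by push_cast; ring,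
      Complex.norm_exp_ofReal_mul_I]
  -- Fourier inversion on the critical line: `∫ K(t) e^{−itu} dt = 2π k(−u)`
  have hinv : ∀ u : ℝ, ∫ t : ℝ, mulFourier k t * cexp (-(I * (t : ℂ) * (u : ℂ))) = 2 * π * k (-u) := by
    intro u
    have h1 := weilMellin_inversion hk (1 / 2) (-u)
    rw [← integral_neg_eq_self _ volume]
    have e : ∀ y : ℝ, mulFourier k (((-y : ℝ) : ℂ)) * cexp (-(I * (((-y : ℝ) : ℂ)) * (u : ℂ))) =
        weilMellin k (1 / 2 + y * I) * cexp (-(y * I) * (((-u : ℝ)) : ℂ)) := by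
      intro y
      rw [mulFourier_eq_weilMellin]
      congr 1
      · congr 1; push_cast; ring
      · congr 1; push_cast; ring
    simp_rw [e]
    have e1 : ∀ y : ℝ, weilMellin k (((1 / 2 : ℝ) : ℂ) + y * I) = weilMellin k (1 / 2 + y * I) := by
      intro y
      congr 1
      push_cast
      ring
    simp_rw [e1] at h1
    rw [h1]
    simp
  -- joint integrability for Fubini
  have hprod : Integrable (fun p : ℝ × ℝ => mulFourier k p.1 * (h p.2 * cexp (-(I * (p.1 : ℂ) * (p.2 : ℂ)))))
      (volume.prod volume) := by
    have h0 := hKi.mul_prod hhi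
    refine h0.norm.mono' ?_ (Filter.Eventually.of_forall fun p => ?_)
    · have hc : Continuous fun p : ℝ × ℝ => cexp (-(I * (p.1 : ℂ) * (p.2 : ℂ))) := by fun_prop
      have := h0.1.mul hc.aestronglyMeasurable
      refine this.congr (Filter.Eventually.of_forall fun p => ?_)
      simp only [Pi.mul_apply]
      ring
    · simp only [norm_mul, hphase, mul_one, le_refl]
  -- the computation
  symm
  calc (1 / (2 * π) : ℂ) * ∫ t : ℝ, mulFourier k t * mulFourier h t
      = (1 / (2 * π) : ℂ) * ∫ t : ℝ, ∫ u : ℝ, mulFourier k t * (h u * cexp (-(I * (t : ℂ) * (u : ℂ)))) := by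
        congr 1
        refine integral_congr_ae (Filter.Eventually.of_forall fun t => ?_)
        simp only [mulFourier, hh_def]
        rw [← integral_const_mul]
    _ = (1 / (2 * π) : ℂ) * ∫ u : ℝ, ∫ t : ℝ, mulFourier k t * (h u * cexp (-(I * (t : ℂ) * (u : ℂ)))) := by
        rw [integral_integral_swap hprod]
    _ = (1 / (2 * π) : ℂ) * ∫ u : ℝ, h u * (2 * π * k (-u)) := by
        congr 1
        refine integral_congr_ae (Filter.Eventually.of_forall fun u => ?_)
        simp only
        rw [← hinv u, ← integral_const_mul]
        refine integral_congr_ae (Filter.Eventually.of_forall fun t => ?_)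
        simp only
        ring
    _ = ∫ u : ℝ, h u * k (-u) := by
        have hπ : (π : ℂ) ≠ 0 := by exact_mod_cast Real.pi_pos.ne'
        rw [← integral_const_mul]
        refine integral_congr_ae (Filter.Eventually.of_forall fun u => ?_)
        simp only
        field_simp
    _ = ∫ u : ℝ, h (-u) * k u := by
        rw [← integral_neg_eq_self _ volume]
        refine integral_congr_ae (Filter.Eventually.of_forall fun u => ?_)
        simp only [neg_neg]
    _ = remainderD k := by
        simp only [remainderD, hh_def]
        refine integral_congr_ae (Filter.Eventually.of_forall fun u => ?_)
        simp only
        rw [Real.exp_neg, traceRemainder_inv]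
        ring

/-- **Eq. (30) «lfourier»** (§2 p. 11): `L(f) = ∫ f̂(t)(2∂_tθ(t) + δ̂(t)) dt/2π` for every test
function (additive avatar `k`; `L = traceL = W_∞ + D`, `f̂ = mulFourier k`, `θ′ = riemannSiegelThetaDeriv`,
`δ̂ = mulFourier (δ ∘ exp)`).  PROVED (`archW_eq_integral_mulFourier_thetaDeriv` +
`remainderD_eq_integral_mulFourier`).  With Cor. 2.3 (i) this is the printed route to Cor. 2.3 (ii)
("the positivity of `L` implies (in fact it is equivalent to) the positivity of the function
`2θ′(t) + δ̂(t)`"). [cite: ConnesConsani2021, §2 eq. (30) p. 11 (chunk p0011:L37–L41)] -/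
theorem traceL_eq_integral_mulFourier {k : ℝ → ℂ} (hk : IsWeilTest k) :
    traceL k = (1 / (2 * π) : ℂ) *
      ∫ t : ℝ, mulFourier k t * (((2 * riemannSiegelThetaDeriv t : ℝ) : ℂ) +
        mulFourier (fun u : ℝ => (traceRemainder (Real.exp u) : ℂ)) t) := by
  have hKi : Integrable (fun t : ℝ => mulFourier k t) := by
    have h1 := (integrable_weilMellin_vertical hk (1 / 2)).comp_neg
    refine h1.congr (Filter.Eventually.of_forall fun t => ?_)
    simp only [mulFourier_eq_weilMellin]
    congr 1
    push_cast
    ring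
  -- integrability of `f̂ · 2θ′` (transport of the digamma integrability along `t ↦ −t`, `θ′` even)
  have hI1 : Integrable fun t : ℝ => mulFourier k t * ((2 * riemannSiegelThetaDeriv t : ℝ) : ℂ) := by
    have hA : Integrable fun t : ℝ => weilMellin k (1 / 2 + t * I) *
        ((Complex.digamma (1 / 4 + t / 2 * I)).re : ℂ) := by
      have h := WeilArchParity.integrable_weilMellin_mul_re_digamma_shift hk (x := 1 / 4) (by norm_num)
      refine h.congr (Filter.Eventually.of_forall fun t => ?_)
      push_cast
      ring_nf
    have hB : Integrable fun t : ℝ => weilMellin k (1 / 2 + t * I) * (Real.log π : ℂ) := by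
      have h := (integrable_weilMellin_vertical hk (1 / 2)).mul_const (Real.log π : ℂ)
      refine h.congr (Filter.Eventually.of_forall fun t => ?_)
      push_cast
      ring_nf
    have hAB := (hA.sub hB).comp_neg
    refine hAB.congr (Filter.Eventually.of_forall fun t => ?_)
    have hθ : ((2 * riemannSiegelThetaDeriv t : ℝ) : ℂ) =
        ((Complex.digamma (1 / 4 + ((-t : ℝ) : ℂ) / 2 * I)).re : ℂ) - (Real.log π : ℂ) := by
      rw [← riemannSiegelThetaDeriv_neg_holds t, riemannSiegelThetaDeriv]
      push_cast
      ring
    have hm : mulFourier k t = weilMellin k (1 / 2 + ((-t : ℝ) : ℂ) * I) := by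
      rw [mulFourier_eq_weilMellin]
      congr 1
      push_cast
      ring
    simp only [Pi.sub_apply]
    rw [hθ, hm]
    ring
  -- continuity (hence measurability) and boundedness of `δ̂`
  set h : ℝ → ℂ := fun u => (traceRemainder (Real.exp u) : ℂ) with hh_def
  have hhi : Integrable h := integrable_traceRemainder_exp.ofReal
  have hphase : ∀ t u : ℝ, ‖cexp (-(I * (t : ℂ) * (u : ℂ)))‖ = 1 := by
    intro t u
    rw [show (-(I * (t : ℂ) * (u : ℂ))) = ((-(t * u) : ℝ) : ℂ) * I by push_cast; ring,
      Complex.norm_exp_ofReal_mul_I]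
  have hcont : Continuous fun t : ℝ => mulFourier h t := by
    show Continuous fun t : ℝ => ∫ u : ℝ, h u * cexp (-(I * (t : ℂ) * (u : ℂ)))
    refine continuous_of_dominated (F := fun (t u : ℝ) => h u * cexp (-(I * (t : ℂ) * (u : ℂ))))
      (bound := fun u => ‖h u‖) (fun t => ?_) (fun t => ?_) hhi.norm ?_
    · have hc : Continuous fun u : ℝ => cexp (-(I * (t : ℂ) * (u : ℂ))) := by fun_prop
      exact hhi.1.mul hc.aestronglyMeasurable
    · exact Filter.Eventually.of_forall fun u => by
        show ‖h u * cexp (-(I * (t : ℂ) * (u : ℂ)))‖ ≤ ‖h u‖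
        rw [norm_mul, hphase, mul_one]
    · exact Filter.Eventually.of_forall fun u => by fun_prop
  have hbdd : ∀ t : ℝ, ‖mulFourier h t‖ ≤ ∫ u : ℝ, ‖h u‖ := by
    intro t
    refine (norm_integral_le_integral_norm _).trans (le_of_eq ?_)
    refine integral_congr_ae (Filter.Eventually.of_forall fun u => ?_)
    simp only [norm_mul, hphase, mul_one]
  have hI2 : Integrable fun t : ℝ => mulFourier k t * mulFourier h t :=
    hKi.mul_bdd hcont.aestronglyMeasurable (Filter.Eventually.of_forall hbdd)
  rw [traceL, archW_eq_integral_mulFourier_thetaDeriv hk, remainderD_eq_integral_mulFourier hk,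
    ← mul_add, ← integral_add hI1 hI2]
  congr 1
  refine integral_congr_ae (Filter.Eventually.of_forall fun t => ?_)
  simp only [hh_def]
  ring

/-! ## Cor. 2.3 (ii) from Cor. 2.3 (i): "the positivity of `L` implies … the positivity of the
function `2θ′(t) + δ̂(t)`" (§2 p. 11, last sentence of the proof) — PROVED

The printed one-line argument is an approximate-identity argument: by eq. (30),
`L(g ∗ g*) = (1/2π)∫ |ĝ(t)|² (2θ′ + δ̂)(t) dt ≥ 0` for every test function `g`; testing with
`g_n(u) = φ(u/n) e^{it₀u}` (`|ĝ_n(t)|² = n²|φ̂(n(t − t₀))|²` concentrates at `t₀`) and letting `n → ∞`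
(dominated convergence: `θ′` grows logarithmically, `δ̂` is bounded, `φ̂` decays) gives
`(2θ′ + δ̂)(t₀) ∫|φ̂|² ≥ 0`. -/

/-- `(g ∗ g*)^(t) = |ĝ(t)|²` for real `t` ("the Fourier transform transforms convolution into product
and the involution into complex conjugation", App. A p. 30). [cite: ConnesConsani2021, App. A p. 30; §2 proof of Cor. 2.3 (ii) p. 11] -/
theorem mulFourier_autocorr {g : ℝ → ℂ} (hg : IsWeilTest g) (t : ℝ) :
    mulFourier (weilConv g (weilReflect g)) t = ((‖mulFourier g t‖ ^ 2 : ℝ) : ℂ) := by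
  have hr := hg.weilReflect
  rw [mulFourier_eq_weilMellin,
    weilMellin_weilConv_holds hg.1.continuous hg.2 hr.1.continuous hr.2, ← mulFourier_eq_weilMellin,
    ← mulFourier_eq_weilMellin, mulFourier_weilReflect, Complex.conj_ofReal, Complex.mul_conj,
    Complex.normSq_eq_norm_sq]

/-- `δ̂ = mulFourier (δ ∘ exp)` is continuous and bounded by `‖δ ∘ exp‖₁` (Fourier transform of an
integrable function, §2 p. 11). [cite: ConnesConsani2021, §2 p. 11 (chunk p0011:L51–L53)] -/
theorem continuous_mulFourier_traceRemainder :
    Continuous fun t : ℝ => mulFourier (fun u : ℝ => (traceRemainder (Real.exp u) : ℂ)) t := by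
  set h : ℝ → ℂ := fun u => (traceRemainder (Real.exp u) : ℂ) with hh_def
  have hhi : Integrable h := integrable_traceRemainder_exp.ofReal
  have hphase : ∀ t u : ℝ, ‖cexp (-(I * (t : ℂ) * (u : ℂ)))‖ = 1 := by
    intro t u
    rw [show (-(I * (t : ℂ) * (u : ℂ))) = ((-(t * u) : ℝ) : ℂ) * I by push_cast; ring,
      Complex.norm_exp_ofReal_mul_I]
  show Continuous fun t : ℝ => ∫ u : ℝ, h u * cexp (-(I * (t : ℂ) * (u : ℂ)))
  refine continuous_of_dominated (F := fun (t u : ℝ) => h u * cexp (-(I * (t : ℂ) * (u : ℂ))))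
    (bound := fun u => ‖h u‖) (fun t => ?_) (fun t => ?_) hhi.norm ?_
  · have hc : Continuous fun u : ℝ => cexp (-(I * (t : ℂ) * (u : ℂ))) := by fun_prop
    exact hhi.1.mul hc.aestronglyMeasurable
  · exact Filter.Eventually.of_forall fun u => by
      show ‖h u * cexp (-(I * (t : ℂ) * (u : ℂ)))‖ ≤ ‖h u‖
      rw [norm_mul, hphase, mul_one]
  · exact Filter.Eventually.of_forall fun u => by fun_prop

/-- `‖f̂(t)‖ ≤ ∫ ‖f‖` for the multiplicative Fourier transform in the additive variable.
[cite: ConnesConsani2021, App. A p. 30] -/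
theorem norm_mulFourier_le (f : ℝ → ℂ) (t : ℝ) : ‖mulFourier f t‖ ≤ ∫ u : ℝ, ‖f u‖ := by
  unfold mulFourier
  refine (norm_integral_le_integral_norm _).trans (le_of_eq ?_)
  refine integral_congr_ae (Filter.Eventually.of_forall fun u => ?_)
  show ‖f u * cexp (-(I * (t : ℂ) * (u : ℂ)))‖ = ‖f u‖
  rw [norm_mul, show (-(I * (t : ℂ) * (u : ℂ))) = ((-(t * u) : ℝ) : ℂ) * I by push_cast; ring,
    Complex.norm_exp_ofReal_mul_I, mul_one]

/-- The integrand of eq. (30) is integrable: `t ↦ f̂(t)(2θ′(t) + δ̂(t)) ∈ L¹` for a test function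
(decay of `f̂` against the logarithmic growth of `θ′`; `δ̂` bounded). [cite: ConnesConsani2021, §2 eq. (30) p. 11] -/
theorem integrable_mulFourier_mul_thetaDeriv_add {k : ℝ → ℂ} (hk : IsWeilTest k) :
    Integrable fun t : ℝ => mulFourier k t * (((2 * riemannSiegelThetaDeriv t : ℝ) : ℂ) +
      mulFourier (fun u : ℝ => (traceRemainder (Real.exp u) : ℂ)) t) := by
  have hKi : Integrable (fun t : ℝ => mulFourier k t) := by
    have h1 := (integrable_weilMellin_vertical hk (1 / 2)).comp_neg
    refine h1.congr (Filter.Eventually.of_forall fun t => ?_)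
    simp only [mulFourier_eq_weilMellin]
    congr 1
    push_cast
    ring
  have hI1 : Integrable fun t : ℝ => mulFourier k t * ((2 * riemannSiegelThetaDeriv t : ℝ) : ℂ) := by
    have hA : Integrable fun t : ℝ => weilMellin k (1 / 2 + t * I) *
        ((Complex.digamma (1 / 4 + t / 2 * I)).re : ℂ) := by
      have h := WeilArchParity.integrable_weilMellin_mul_re_digamma_shift hk (x := 1 / 4) (by norm_num)
      refine h.congr (Filter.Eventually.of_forall fun t => ?_)
      push_cast
      ring_nf
    have hB : Integrable fun t : ℝ => weilMellin k (1 / 2 + t * I) * (Real.log π : ℂ) := by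
      have h := (integrable_weilMellin_vertical hk (1 / 2)).mul_const (Real.log π : ℂ)
      refine h.congr (Filter.Eventually.of_forall fun t => ?_)
      push_cast
      ring_nf
    have hAB := (hA.sub hB).comp_neg
    refine hAB.congr (Filter.Eventually.of_forall fun t => ?_)
    have hθ : ((2 * riemannSiegelThetaDeriv t : ℝ) : ℂ) =
        ((Complex.digamma (1 / 4 + ((-t : ℝ) : ℂ) / 2 * I)).re : ℂ) - (Real.log π : ℂ) := by
      rw [← riemannSiegelThetaDeriv_neg_holds t, riemannSiegelThetaDeriv]
      push_cast
      ring
    have hm : mulFourier k t = weilMellin k (1 / 2 + ((-t : ℝ) : ℂ) * I) := by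
      rw [mulFourier_eq_weilMellin]
      congr 1
      push_cast
      ring
    simp only [Pi.sub_apply]
    rw [hθ, hm]
    ring
  have hI2 : Integrable fun t : ℝ => mulFourier k t *
      mulFourier (fun u : ℝ => (traceRemainder (Real.exp u) : ℂ)) t :=
    hKi.mul_bdd continuous_mulFourier_traceRemainder.aestronglyMeasurable
      (Filter.Eventually.of_forall fun t => norm_mulFourier_le _ t)
  refine (hI1.add hI2).congr (Filter.Eventually.of_forall fun t => ?_)
  simp only [Pi.add_apply, mul_add]

/-- **`Re L(g ∗ g*) = (1/2π) ∫ |ĝ(t)|² (2θ′(t) + Re δ̂(t)) dt`** (eq. (30) on the convolution algebra,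
with `(g ∗ g*)^ = |ĝ|²`). [cite: ConnesConsani2021, §2 eq. (30) p. 11 (chunk p0011:L37–L41)] -/
theorem re_traceL_autocorr {g : ℝ → ℂ} (hg : IsWeilTest g) :
    (traceL (weilConv g (weilReflect g))).re = 1 / (2 * π) *
      ∫ t : ℝ, ‖mulFourier g t‖ ^ 2 * (2 * riemannSiegelThetaDeriv t +
        (mulFourier (fun u : ℝ => (traceRemainder (Real.exp u) : ℂ)) t).re) := by
  have hgg := hg.weilConv hg.weilReflect
  rw [traceL_eq_integral_mulFourier hgg]
  have hint := integrable_mulFourier_mul_thetaDeriv_add hgg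
  rw [show (1 / (2 * π) : ℂ) = ((1 / (2 * π) : ℝ) : ℂ) by push_cast; ring, Complex.re_ofReal_mul]
  have hre := Complex.reCLM.integral_comp_comm hint
  simp only [Complex.reCLM_apply] at hre
  rw [← hre]
  congr 1
  refine integral_congr_ae (Filter.Eventually.of_forall fun t => ?_)
  simp only
  rw [mulFourier_autocorr hg]
  simp only [Complex.mul_re, Complex.ofReal_re, Complex.ofReal_im, Complex.add_re, Complex.add_im,
    zero_mul, sub_zero]

/-- Logarithmic growth of `2θ′`: `|2θ′(t)| ≤ C + log(1 + |t|)` (from the digamma bound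
`‖ψ(a + iy)‖ ≤ C + log(1+|y|)`, `θ′ = Re ψ(1/4 + it/2)/2 − (log π)/2`). [cite: ConnesConsani2021, §2 p. 11 (chunk p0011:L53)] -/
theorem exists_abs_two_mul_thetaDeriv_le :
    ∃ C : ℝ, ∀ t : ℝ, |2 * riemannSiegelThetaDeriv t| ≤ C + Real.log (1 + |t|) := by
  obtain ⟨C, hC⟩ := Literature.Analysis.SpecialFunctions.Complex.exists_norm_digamma_vertical_le
    (a := 1 / 4) (by norm_num)
  refine ⟨C + |Real.log π|, fun t => ?_⟩
  have h1 := hC (t / 2)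
  have hw : ((1 / 4 : ℝ) : ℂ) + ((t / 2 : ℝ) : ℂ) * I = 1 / 4 + (t : ℂ) / 2 * I := by push_cast; ring
  rw [hw] at h1
  have h2 : |(Complex.digamma (1 / 4 + (t : ℂ) / 2 * I)).re| ≤ C + Real.log (1 + |t / 2|) :=
    (Complex.abs_re_le_norm _).trans h1
  have h3 : Real.log (1 + |t / 2|) ≤ Real.log (1 + |t|) := by
    refine Real.log_le_log (by positivity) ?_
    rw [abs_div, abs_two]
    linarith [abs_nonneg t]
  have h4 : 2 * riemannSiegelThetaDeriv t =
      (Complex.digamma (1 / 4 + (t : ℂ) / 2 * I)).re - Real.log π := by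
    rw [riemannSiegelThetaDeriv]; ring
  rw [h4]
  calc |(Complex.digamma (1 / 4 + (t : ℂ) / 2 * I)).re - Real.log π|
      ≤ |(Complex.digamma (1 / 4 + (t : ℂ) / 2 * I)).re| + |Real.log π| := abs_sub _ _
    _ ≤ C + |Real.log π| + Real.log (1 + |t|) := by linarith

/-- `f̂` is continuous for a test function (through `continuous_weilMellin`). [cite: ConnesConsani2021, App. A p. 30] -/
theorem continuous_mulFourier {φ : ℝ → ℂ} (hφ : IsWeilTest φ) : Continuous fun s : ℝ => mulFourier φ s := by
  have h := (continuous_weilMellin hφ.1.continuous hφ.2).comp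
    (show Continuous fun s : ℝ => (1 / 2 : ℂ) - I * (s : ℂ) by fun_prop)
  refine h.congr (fun s => ?_)
  simp only [Function.comp_apply, mulFourier_eq_weilMellin]

/-- `f̂ ∈ L¹` for a test function (`integrable_weilMellin_vertical` on `Re s = 1/2`).
[cite: ConnesConsani2021, App. A p. 30] -/
theorem integrable_mulFourier {φ : ℝ → ℂ} (hφ : IsWeilTest φ) : Integrable fun s : ℝ => mulFourier φ s := by
  have h1 := (integrable_weilMellin_vertical hφ (1 / 2)).comp_neg
  refine h1.congr (Filter.Eventually.of_forall fun t => ?_)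
  simp only [mulFourier_eq_weilMellin]
  congr 1
  push_cast
  ring

/-- The modulated and rescaled test function `u ↦ φ(u/R) e^{it₀u}` is a test function.
[cite: ConnesConsani2021, §2 proof of Cor. 2.3 (ii) p. 11] -/
private theorem isWeilTest_modScale {φ : ℝ → ℂ} (hφ : IsWeilTest φ) (t₀ : ℝ) {R : ℝ} (hR : R ≠ 0) :
    IsWeilTest fun u : ℝ => φ (R⁻¹ * u) * cexp (I * t₀ * u) := by
  refine ⟨?_, ?_⟩
  · have h1 : ContDiff ℝ ∞ fun u : ℝ => φ (R⁻¹ * u) := hφ.1.comp (contDiff_const.mul contDiff_id)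
    have ho : ContDiff ℝ ∞ (fun u : ℝ => (u : ℂ)) := Complex.ofRealCLM.contDiff
    have h2 : ContDiff ℝ ∞ fun u : ℝ => cexp (I * t₀ * u) :=
      Complex.contDiff_exp.comp ((contDiff_const (c := I * (t₀ : ℂ))).mul ho)
    exact h1.mul h2
  · have h1 : HasCompactSupport fun u : ℝ => φ (R⁻¹ * u) := by
      have := hφ.2.comp_smul (inv_ne_zero hR)
      simpa only [smul_eq_mul] using this
    exact h1.mul_right

/-- Its Fourier transform: `(φ(·/R) e^{it₀·})^(t) = R φ̂(R(t − t₀))` (`R > 0`). [cite: ConnesConsani2021, §2 proof of Cor. 2.3 (ii) p. 11] -/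
private theorem mulFourier_modScale (φ : ℝ → ℂ) (t₀ : ℝ) {R : ℝ} (hR : 0 < R) (t : ℝ) :
    mulFourier (fun u : ℝ => φ (R⁻¹ * u) * cexp (I * t₀ * u)) t =
      (R : ℂ) * mulFourier φ (((R * (t - t₀) : ℝ)) : ℂ) := by
  unfold mulFourier
  have hR0 : (R : ℂ) ≠ 0 := by exact_mod_cast hR.ne'
  have hH : ∀ u : ℝ, φ (R⁻¹ * u) * cexp (I * t₀ * u) * cexp (-(I * (t : ℂ) * (u : ℂ))) =
      (fun v : ℝ => φ v * cexp (-(I * (((R * (t - t₀) : ℝ)) : ℂ) * (v : ℂ)))) (R⁻¹ * u) := by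
    intro u
    simp only
    rw [mul_assoc, ← Complex.exp_add]
    congr 2
    push_cast
    field_simp
    ring
  simp_rw [hH]
  rw [Measure.integral_comp_mul_left (fun v : ℝ => φ v * cexp (-(I * (((R * (t - t₀) : ℝ)) : ℂ) * (v : ℂ))))
    R⁻¹, inv_inv, abs_of_pos hR, ← Complex.coe_smul, smul_eq_mul]

/-- The quadratic integral after modulation and rescaling:
`∫ |R φ̂(R(t−t₀))|² Φ(t) dt = R ∫ |φ̂(s)|² Φ(t₀ + s/R) ds`. [cite: ConnesConsani2021, §2 proof of Cor. 2.3 (ii) p. 11] -/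
private theorem integral_normSq_modScale (φ : ℝ → ℂ) (Φ : ℝ → ℝ) (t₀ : ℝ) {R : ℝ} (hR : 0 < R) :
    ∫ t : ℝ, ‖mulFourier (fun u : ℝ => φ (R⁻¹ * u) * cexp (I * t₀ * u)) t‖ ^ 2 * Φ t =
      R * ∫ s : ℝ, ‖mulFourier φ s‖ ^ 2 * Φ (t₀ + R⁻¹ * s) := by
  set G : ℝ → ℝ := fun s => ‖mulFourier φ s‖ ^ 2 * Φ (t₀ + R⁻¹ * s) with hG
  have h1 : ∀ t : ℝ, ‖mulFourier (fun u : ℝ => φ (R⁻¹ * u) * cexp (I * t₀ * u)) t‖ ^ 2 * Φ t =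
      R ^ 2 * G (R * (t - t₀)) := by
    intro t
    rw [mulFourier_modScale φ t₀ hR, norm_mul, Complex.norm_real, Real.norm_eq_abs, abs_of_pos hR,
      mul_pow, hG]
    simp only
    have : t₀ + R⁻¹ * (R * (t - t₀)) = t := by field_simp; ring
    rw [this, mul_assoc]
  simp_rw [h1]
  rw [integral_const_mul]
  have h2 : ∫ t : ℝ, G (R * (t - t₀)) = ∫ t : ℝ, G (R * t) := by
    have := integral_sub_right_eq_self (μ := (volume : Measure ℝ)) (fun t : ℝ => G (R * t)) t₀
    simpa only using this
  rw [h2, Measure.integral_comp_mul_left G R, abs_of_pos (inv_pos.2 hR), smul_eq_mul]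
  field_simp

/-- **Cor. 2.3 (ii) follows from Cor. 2.3 (i)** ("the positivity of `L` implies (in fact it is
equivalent to) the positivity of the function `2θ′(t) + δ̂(t)`", §2 p. 11, last sentence of the
proof).  PROVED by the approximate-identity argument sketched in the section docstring (eq. (30) in
the form `re_traceL_autocorr`, test functions `φ(u/n)e^{it₀u}` with `φ` a smooth bump, dominated
convergence with the logarithmic growth of `θ′` and the boundedness of `δ̂`).  Hence the named fact
`CC2021_cor_2_3_ii` reduces to `CC2021_cor_2_3_i`, itself a consequence of `CC2021_prop_2_2_iii`.
[cite: ConnesConsani2021, §2 Cor. 2.3 (ii) (= arXiv Cor. 11 (ii)), proof p. 11 (chunk p0011:L37–L41)] -/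
theorem cor_2_3_ii_of_cor_2_3_i (h : CC2021_cor_2_3_i) : CC2021_cor_2_3_ii := by
  intro t₀
  -- the function `Φ = 2θ′ + Re δ̂`
  set Φ : ℝ → ℝ := fun t => 2 * riemannSiegelThetaDeriv t +
    (mulFourier (fun u : ℝ => (traceRemainder (Real.exp u) : ℂ)) t).re with hΦ_def
  show 0 ≤ Φ t₀
  have hΦc : Continuous Φ :=
    (continuous_const.mul continuous_riemannSiegelThetaDeriv_holds).add
      (Complex.continuous_re.comp continuous_mulFourier_traceRemainder)
  obtain ⟨C₁, hC₁⟩ := exists_abs_two_mul_thetaDeriv_le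
  set M₁ : ℝ := ∫ u : ℝ, ‖(traceRemainder (Real.exp u) : ℂ)‖ with hM₁_def
  have hM₁ : 0 ≤ M₁ := integral_nonneg fun u => norm_nonneg _
  set K : ℝ := |C₁| + M₁ + Real.log (1 + |t₀|) with hK_def
  have hK0 : 0 ≤ K := by
    have : 0 ≤ Real.log (1 + |t₀|) := Real.log_nonneg (by linarith [abs_nonneg t₀])
    positivity
  have hΦb : ∀ t, |Φ t| ≤ |C₁| + M₁ + Real.log (1 + |t|) := by
    intro t
    have h1 := hC₁ t
    have h2 : |(mulFourier (fun u : ℝ => (traceRemainder (Real.exp u) : ℂ)) t).re| ≤ M₁ :=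
      (Complex.abs_re_le_norm _).trans (norm_mulFourier_le _ t)
    calc |Φ t| ≤ |2 * riemannSiegelThetaDeriv t| +
        |(mulFourier (fun u : ℝ => (traceRemainder (Real.exp u) : ℂ)) t).re| := abs_add_le _ _
      _ ≤ |C₁| + M₁ + Real.log (1 + |t|) := by linarith [le_abs_self C₁]
  -- growth along the rescaled arguments: `|Φ(t₀ + r s)| ≤ K + log(1+|s|)` for `|r| ≤ 1`
  have hΦb' : ∀ (r s : ℝ), |r| ≤ 1 → |Φ (t₀ + r * s)| ≤ K + Real.log (1 + |s|) := by
    intro r s hr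
    have h1 := hΦb (t₀ + r * s)
    have h2 : Real.log (1 + |t₀ + r * s|) ≤ Real.log (1 + |t₀|) + Real.log (1 + |s|) := by
      rw [← Real.log_mul (by positivity) (by positivity)]
      refine Real.log_le_log (by positivity) ?_
      have h3 : |t₀ + r * s| ≤ |t₀| + |s| := by
        calc |t₀ + r * s| ≤ |t₀| + |r * s| := abs_add_le _ _
          _ = |t₀| + |r| * |s| := by rw [abs_mul]
          _ ≤ |t₀| + 1 * |s| := by gcongr
          _ = |t₀| + |s| := by rw [one_mul]
      nlinarith [abs_nonneg t₀, abs_nonneg s]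
    rw [hK_def]
    linarith
  -- the bump `φ`
  let b : ContDiffBump (0 : ℝ) := ⟨1, 2, one_pos, one_lt_two⟩
  set φ : ℝ → ℂ := fun u => ((b u : ℝ) : ℂ) with hφ_def
  have hφ : IsWeilTest φ :=
    ⟨Complex.ofRealCLM.contDiff.comp b.contDiff, b.hasCompactSupport.comp_left Complex.ofReal_zero⟩
  set M : ℝ := ∫ u : ℝ, ‖φ u‖ with hM_def
  have hM0 : 0 ≤ M := integral_nonneg fun u => norm_nonneg _
  have hMb : ∀ s : ℝ, ‖mulFourier φ s‖ ≤ M := fun s => norm_mulFourier_le φ s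
  have hφc : Continuous fun s : ℝ => mulFourier φ s := continuous_mulFourier hφ
  have hφi : Integrable fun s : ℝ => mulFourier φ s := integrable_mulFourier hφ
  -- `φ̂(0) = ∫ b > 0`
  have hφ0 : mulFourier φ 0 = ((∫ u : ℝ, b u : ℝ) : ℂ) := by
    simp only [mulFourier, hφ_def, mul_zero, zero_mul, neg_zero, Complex.exp_zero, mul_one]
    exact integral_ofReal
  have hφ0' : 0 < ‖mulFourier φ 0‖ := by
    rw [hφ0, Complex.norm_real, Real.norm_eq_abs, abs_of_pos (b.integral_pos (μ := volume))]
    exact b.integral_pos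
  -- positivity along the approximate identity: `0 ≤ I_n := ∫ |φ̂(s)|² Φ(t₀ + s/(n+1)) ds`
  have hI : ∀ n : ℕ, 0 ≤ ∫ s : ℝ, ‖mulFourier φ s‖ ^ 2 * Φ (t₀ + ((n : ℝ) + 1)⁻¹ * s) := by
    intro n
    have hR : (0 : ℝ) < n + 1 := by positivity
    have hg := isWeilTest_modScale hφ t₀ hR.ne'
    have h0 := h _ hg
    rw [re_traceL_autocorr hg] at h0
    change 0 ≤ 1 / (2 * π) *
      ∫ t : ℝ, ‖mulFourier (fun u : ℝ => φ (((n : ℝ) + 1)⁻¹ * u) * cexp (I * t₀ * u)) t‖ ^ 2 * Φ t at h0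
    rw [integral_normSq_modScale φ Φ t₀ hR] at h0
    have hπ : (0 : ℝ) < 1 / (2 * π) := by positivity
    exact (mul_nonneg_iff_of_pos_left hR).1 ((mul_nonneg_iff_of_pos_left hπ).1 h0)
  -- dominated convergence: `I_n → Φ(t₀) ∫ |φ̂|²`
  have hlog : ∀ s : ℝ, 0 ≤ K + Real.log (1 + |s|) := fun s => by
    have := Real.log_nonneg (show (1 : ℝ) ≤ 1 + |s| by linarith [abs_nonneg s])
    linarith
  have hbound_int : Integrable fun s : ℝ => M * (‖mulFourier φ s‖ * (K + Real.log (1 + |s|))) := by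
    have hFc : Continuous fun y : ℝ => (((K + Real.log (1 + |y|)) : ℝ) : ℂ) :=
      Complex.continuous_ofReal.comp (continuous_const.add
        ((continuous_const.add continuous_abs).log fun y =>
          ne_of_gt (by positivity : (0 : ℝ) < 1 + |y|)))
    have hFb : ∀ y : ℝ, ‖(((K + Real.log (1 + |y|)) : ℝ) : ℂ)‖ ≤ K + Real.log (1 + |y|) := by
      intro y
      rw [Complex.norm_real, Real.norm_eq_abs, abs_of_nonneg (hlog y)]
    have h1 := ((integrable_mul_weilMellin_vertical_of_norm_le_log hφ (1 / 2) hFc hFb).comp_neg).norm.const_mul M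
    refine h1.congr (Filter.Eventually.of_forall fun s => ?_)
    have hw : weilMellin φ (((1 / 2 : ℝ) : ℂ) + ((-s : ℝ) : ℂ) * I) = mulFourier φ s := by
      rw [mulFourier_eq_weilMellin]
      congr 1
      push_cast
      ring
    simp only [norm_mul, Complex.norm_real, Real.norm_eq_abs, abs_neg, hw, abs_of_nonneg (hlog s)]
    ring
  have hlim : Filter.Tendsto (fun n : ℕ => ∫ s : ℝ, ‖mulFourier φ s‖ ^ 2 * Φ (t₀ + ((n : ℝ) + 1)⁻¹ * s))
      Filter.atTop (nhds (∫ s : ℝ, ‖mulFourier φ s‖ ^ 2 * Φ t₀)) := by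
    refine tendsto_integral_of_dominated_convergence
      (fun s => M * (‖mulFourier φ s‖ * (K + Real.log (1 + |s|)))) (fun n => ?_) hbound_int
      (fun n => ?_) ?_
    · exact ((hφc.norm.pow 2).mul
        (hΦc.comp (continuous_const.add (continuous_const.mul continuous_id)))).aestronglyMeasurable
    · refine Filter.Eventually.of_forall fun s => ?_
      have hr : |((n : ℝ) + 1)⁻¹| ≤ 1 := by
        rw [abs_of_pos (by positivity)]
        exact inv_le_one_of_one_le₀ (by linarith [(Nat.cast_nonneg n : (0 : ℝ) ≤ n)])
      have h1 := hΦb' _ s hr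
      have h3 : ‖mulFourier φ s‖ ^ 2 ≤ M * ‖mulFourier φ s‖ := by
        rw [sq]
        exact mul_le_mul_of_nonneg_right (hMb s) (norm_nonneg _)
      rw [Real.norm_eq_abs, abs_mul, abs_pow, abs_norm]
      calc ‖mulFourier φ s‖ ^ 2 * |Φ (t₀ + ((n : ℝ) + 1)⁻¹ * s)|
          ≤ (M * ‖mulFourier φ s‖) * (K + Real.log (1 + |s|)) :=
            mul_le_mul h3 h1 (abs_nonneg _) (by positivity)
        _ = M * (‖mulFourier φ s‖ * (K + Real.log (1 + |s|))) := by ring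
    · refine Filter.Eventually.of_forall fun s => ?_
      have ht : Filter.Tendsto (fun n : ℕ => t₀ + ((n : ℝ) + 1)⁻¹ * s) Filter.atTop
          (nhds (t₀ + 0 * s)) := by
        refine tendsto_const_nhds.add (Filter.Tendsto.mul_const s ?_)
        simpa only [one_div] using tendsto_one_div_add_atTop_nhds_zero_nat (𝕜 := ℝ)
      rw [zero_mul, add_zero] at ht
      exact tendsto_const_nhds.mul ((hΦc.tendsto t₀).comp ht)
  -- conclusion: `Φ(t₀) ∫ |φ̂|² ≥ 0` and `∫ |φ̂|² > 0`
  have hge : 0 ≤ ∫ s : ℝ, ‖mulFourier φ s‖ ^ 2 * Φ t₀ := ge_of_tendsto' hlim hI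
  rw [integral_mul_const] at hge
  have hP : 0 < ∫ s : ℝ, ‖mulFourier φ s‖ ^ 2 := by
    have hint : Integrable fun s : ℝ => ‖mulFourier φ s‖ ^ 2 := by
      refine (hφi.norm.const_mul M).mono' (hφc.norm.pow 2).aestronglyMeasurable
        (Filter.Eventually.of_forall fun s => ?_)
      rw [Real.norm_eq_abs, abs_pow, abs_norm, sq]
      exact mul_le_mul_of_nonneg_right (hMb s) (norm_nonneg _)
    rw [integral_pos_iff_support_of_nonneg (fun s => sq_nonneg _) hint]
    refine IsOpen.measure_pos _ (hφc.norm.pow 2).isOpen_support ⟨0, ?_⟩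
    rw [Function.mem_support]
    exact pow_ne_zero 2 hφ0'.ne'
  exact (mul_nonneg_iff_of_pos_left hP).1 hge

open scoped Topology

/-! ## Eq. (26): `δ` near `ρ = 1` — `Si′ = sinc`, continuity of `δ`, `δ′(1⁺) = 1`, the jump of `δ′` -/

/-- `Si(x) = ∫₀ˣ sinc t dt` (the integrands differ only at `t = 0`). [cite: ConnesConsani2021, §2 eq. (25)–(26) p. 11 (chunk p0011:L10–L17)] -/
theorem sinIntegral_eq_integral_sinc (x : ℝ) :
    sinIntegral x = ∫ t in (0 : ℝ)..x, Real.sinc t := by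
  unfold sinIntegral
  refine intervalIntegral.integral_congr_ae ?_
  filter_upwards [compl_mem_ae_iff.mpr (measure_singleton (0 : ℝ))] with t ht _
  have ht0 : t ≠ 0 := fun h => ht (by simp [h])
  exact (Real.sinc_of_ne_zero ht0).symm

/-- `Si′(x) = sinc x` for every real `x` (fundamental theorem of calculus, `sinc` continuous); "`Si` … an
entire function" (§2 p. 11). [cite: ConnesConsani2021, §2 eq. (25)–(26) p. 11 (chunk p0011:L10–L17)] -/
theorem hasDerivAt_sinIntegral (x : ℝ) : HasDerivAt sinIntegral (Real.sinc x) x := by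
  have h : sinIntegral = fun x => ∫ t in (0 : ℝ)..x, Real.sinc t :=
    funext sinIntegral_eq_integral_sinc
  rw [h]
  exact intervalIntegral.integral_hasDerivAt_right (Real.continuous_sinc.intervalIntegrable _ _)
    (Real.continuous_sinc.stronglyMeasurableAtFilter _ _) Real.continuous_sinc.continuousAt

/-- `|sinc t − 1| ≤ t²/6` (from `t − t³/6 < sin t ≤ t` for `t > 0`, and evenness). [cite: ConnesConsani2021, §2 eq. (25)–(26) p. 11 (chunk p0011:L10–L17)] -/
theorem abs_sinc_sub_one_le (t : ℝ) : |Real.sinc t - 1| ≤ t ^ 2 / 6 := by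
  suffices key : ∀ t : ℝ, 0 < t → |Real.sinc t - 1| ≤ t ^ 2 / 6 by
    rcases lt_trichotomy t 0 with ht | rfl | ht
    · have := key (-t) (neg_pos.mpr ht)
      rwa [Real.sinc_neg, neg_sq] at this
    · simp
    · exact key t ht
  intro t ht
  rw [Real.sinc_of_ne_zero ht.ne']
  have h1 : Real.sin t / t ≤ 1 := (div_le_one ht).mpr (Real.sin_le ht.le)
  have h2 : 1 - t ^ 2 / 6 ≤ Real.sin t / t := by
    rw [le_div_iff₀ ht]
    nlinarith [Real.sin_gt_sub_cube ht]
  rw [abs_sub_comm, abs_of_nonneg (by linarith)]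
  linarith

/-- `|Si(x) − x| ≤ |x|³/18` (so `Si(b)/b = 1 + O(b²)`, the removable singularity of (25) at `ρ = 1`). [cite: ConnesConsani2021, §2 eq. (25)–(26) p. 11 (chunk p0011:L10–L17)] -/
theorem abs_sinIntegral_sub_self_le (x : ℝ) : |sinIntegral x - x| ≤ |x| ^ 3 / 18 := by
  suffices key : ∀ x : ℝ, 0 ≤ x → |sinIntegral x - x| ≤ x ^ 3 / 18 by
    by_cases hx : 0 ≤ x
    · rw [abs_of_nonneg hx]; exact key x hx
    · have hx' : x < 0 := not_le.mp hx
      have h := key (-x) (neg_nonneg.mpr hx'.le)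
      have e : sinIntegral (-x) - -x = -(sinIntegral x - x) := by rw [sinIntegral_neg]; ring
      rw [e, abs_neg] at h
      rwa [abs_of_neg hx']
  intro x hx
  have hrepr : sinIntegral x - x = ∫ t in (0 : ℝ)..x, (Real.sinc t - 1) := by
    rw [intervalIntegral.integral_sub (Real.continuous_sinc.intervalIntegrable (μ := volume) _ _)
        (intervalIntegrable_const (μ := volume)),
      sinIntegral_eq_integral_sinc, intervalIntegral.integral_const, sub_zero, smul_eq_mul, mul_one]
  rw [hrepr]
  have hb : |∫ t in (0 : ℝ)..x, (Real.sinc t - 1)| ≤ ∫ t in (0 : ℝ)..x, t ^ 2 / 6 := by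
    have := intervalIntegral.norm_integral_le_of_norm_le (μ := volume) hx
      (f := fun t => Real.sinc t - 1) (g := fun t => t ^ 2 / 6)
      (Filter.Eventually.of_forall fun t _ => by
        rw [Real.norm_eq_abs]; exact abs_sinc_sub_one_le t)
      (((continuous_pow 2).div_const _).intervalIntegrable (μ := volume) _ _)
    simpa [Real.norm_eq_abs] using this
  refine hb.trans (le_of_eq ?_)
  rw [intervalIntegral.integral_div, integral_pow]
  ring

/-- The factor `Si(2π(r−1))/(2π(r−1))` of (25), completed by `1` at `r = 1`, is differentiable at
`r = 1` with derivative `0` (`Si(b)/b = 1 + O(b²)`). [cite: ConnesConsani2021, §2 eq. (25)–(26) p. 11 (chunk p0011:L10–L17)] -/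
theorem hasDerivAt_sinIntegral_div_sub_one :
    HasDerivAt (fun r : ℝ => if r = 1 then (1 : ℝ)
      else sinIntegral (2 * π * (r - 1)) / (2 * π * (r - 1))) 0 1 := by
  rw [hasDerivAt_iff_isLittleO]
  refine Asymptotics.IsBigO.trans_isLittleO ?_ (Asymptotics.isLittleO_pow_sub_sub (1 : ℝ) one_lt_two)
  refine Asymptotics.IsBigO.of_bound ((2 * π) ^ 2 / 18) (Filter.Eventually.of_forall fun r => ?_)
  rcases eq_or_ne r 1 with rfl | hr
  · simp
  · rw [if_neg hr, if_pos rfl, smul_zero, sub_zero]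
    simp only [Real.norm_eq_abs, abs_pow, sq_abs]
    have hb : 2 * π * (r - 1) ≠ 0 := mul_ne_zero (by positivity) (sub_ne_zero.mpr hr)
    have hb' : 0 < |2 * π * (r - 1)| := abs_pos.mpr hb
    have key := abs_sinIntegral_sub_self_le (2 * π * (r - 1))
    rw [div_sub_one hb, abs_div, div_le_iff₀ hb']
    calc |sinIntegral (2 * π * (r - 1)) - 2 * π * (r - 1)|
        ≤ |2 * π * (r - 1)| ^ 3 / 18 := key
      _ = (2 * π) ^ 2 / 18 * (r - 1) ^ 2 * |2 * π * (r - 1)| := by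
        rw [pow_succ, abs_mul, abs_of_pos (by positivity : (0:ℝ) < 2 * π), mul_pow, sq_abs]
        ring

/-- The factor `Si(2π(1+r))/(2π(1+r))` of (25) is differentiable at `r = 1` with derivative
`−Si(4π)/(8π)` (`sin 4π = 0`). [cite: ConnesConsani2021, §2 eq. (25)–(26) p. 11 (chunk p0011:L10–L17)] -/
theorem hasDerivAt_sinIntegral_div_add_one :
    HasDerivAt (fun r : ℝ => sinIntegral (2 * π * (1 + r)) / (2 * π * (1 + r)))
      (-(sinIntegral (4 * π) / (8 * π))) 1 := by
  have ha : HasDerivAt (fun r : ℝ => 2 * π * (1 + r)) (2 * π) 1 := by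
    simpa using ((hasDerivAt_id (1 : ℝ)).const_add 1).const_mul (2 * π)
  have hS : HasDerivAt (fun r : ℝ => sinIntegral (2 * π * (1 + r)))
      (Real.sinc (2 * π * (1 + 1)) * (2 * π)) 1 := (hasDerivAt_sinIntegral _).comp 1 ha
  have h4 : 2 * π * (1 + 1 : ℝ) = 4 * π := by ring
  have hsin : Real.sin (4 * π) = 0 := by exact_mod_cast Real.sin_nat_mul_pi 4
  have hsinc : Real.sinc (2 * π * (1 + 1)) = 0 := by
    rw [h4, Real.sinc_of_ne_zero (by positivity), hsin, zero_div]
  have hne : 2 * π * (1 + 1 : ℝ) ≠ 0 := by positivity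
  have h := hS.div ha hne
  beta_reduce at h
  rw [hsinc, h4] at h
  refine h.congr_deriv ?_
  field_simp
  ring

/-- The closed form (25) is differentiable at `r = 1` with derivative `1`: the first-order term
`(ρ − 1)` of the printed expansion (26). [cite: ConnesConsani2021, §2 eq. (25)–(26) p. 11 (chunk p0011:L10–L17)] -/
theorem hasDerivAt_traceRemainderAux_one : HasDerivAt traceRemainderAux 1 1 := by
  have hsqrt : HasDerivAt (fun r : ℝ => 2 * Real.sqrt r) 1 1 := by
    have := (Real.hasDerivAt_sqrt one_ne_zero).const_mul 2
    simpa using this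
  have hsum := hasDerivAt_sinIntegral_div_add_one.add hasDerivAt_sinIntegral_div_sub_one
  have h := hsqrt.mul hsum
  have heq : traceRemainderAux = fun r => (2 * Real.sqrt r) *
      (sinIntegral (2 * π * (1 + r)) / (2 * π * (1 + r)) +
        (if r = 1 then 1 else sinIntegral (2 * π * (r - 1)) / (2 * π * (r - 1)))) := by
    funext r; simp only [traceRemainderAux]
  rw [heq]
  refine h.congr_deriv ?_
  have h4 : 2 * π * (1 + 1 : ℝ) = 4 * π := by ring
  simp only [Pi.add_apply, ↓reduceIte, Real.sqrt_one, h4]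
  field_simp
  ring

/-- **Eq. (26), first order: `δ′(1⁺) = 1`** — the right derivative of `δ` at `ρ = 1` is `1`
("`δ(ρ) = 2(Si(4π)/(4π)+1) + (ρ−1) − … (ρ ≥ 1)`", §2 p. 11).  PROVED.
[cite: ConnesConsani2021, §2 eq. (26) p. 11 (chunk p0011:L15–L16)] -/
theorem hasDerivWithinAt_traceRemainder_Ici_one : HasDerivWithinAt traceRemainder 1 (Ici 1) 1 :=
  hasDerivAt_traceRemainderAux_one.hasDerivWithinAt.congr
    (fun _ hρ => traceRemainder_of_one_le hρ) (traceRemainder_of_one_le le_rfl)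

/-- **The jump of `δ′` at `ρ = 1`**: the left derivative of `δ` at `1` is `−1` (from `δ(ρ⁻¹) = δ(ρ)`,
Prop. 2.2 (ii), and `δ′(1⁺) = 1`): "this shows that the function `δ(ρ)` has a jump in its first
derivative at `ρ = 1`" (§2 p. 11).  PROVED. [cite: ConnesConsani2021, §2 eq. (26) p. 11 (chunk p0011:L16–L17)] -/
theorem hasDerivWithinAt_traceRemainder_Iic_one :
    HasDerivWithinAt traceRemainder (-1) (Iic 1) 1 := by
  have hinv : HasDerivWithinAt (fun ρ : ℝ => ρ⁻¹) (-1) (Ioc 0 1) 1 := by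
    have := (hasDerivAt_inv one_ne_zero).hasDerivWithinAt (s := Ioc (0 : ℝ) 1)
    simpa using this
  have hmaps : MapsTo (fun ρ : ℝ => ρ⁻¹) (Ioc 0 1) (Ici 1) := fun ρ hρ =>
    (one_le_inv₀ hρ.1).mpr hρ.2
  have hg : HasDerivWithinAt traceRemainder 1 (Ici 1) ((fun ρ : ℝ => ρ⁻¹) 1) := by
    simpa using hasDerivWithinAt_traceRemainder_Ici_one
  have hcomp := hg.comp 1 hinv hmaps
  have heq : traceRemainder ∘ (fun ρ : ℝ => ρ⁻¹) = traceRemainder :=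
    funext fun ρ => traceRemainder_inv ρ
  rw [heq, one_mul] at hcomp
  refine (hcomp.mono_of_mem_nhdsWithin ?_)
  exact mem_nhdsWithin.mpr ⟨Ioi 0, isOpen_Ioi, mem_Ioi.mpr zero_lt_one, fun ρ hρ => ⟨hρ.1, hρ.2⟩⟩

/-- `δ` is not differentiable at `ρ = 1` (`δ′(1⁻) = −1 ≠ 1 = δ′(1⁺)`). [cite: ConnesConsani2021, §2 p. 11 (chunk p0011:L16–L17)] -/
theorem not_differentiableAt_traceRemainder_one : ¬ DifferentiableAt ℝ traceRemainder 1 := by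
  intro h
  have h1 : deriv traceRemainder 1 = 1 :=
    (uniqueDiffOn_Ici (1 : ℝ) 1 self_mem_Ici).eq_deriv _ h.hasDerivAt.hasDerivWithinAt
      hasDerivWithinAt_traceRemainder_Ici_one
  have h2 : deriv traceRemainder 1 = -1 :=
    (uniqueDiffOn_Iic (1 : ℝ) 1 self_mem_Iic).eq_deriv _ h.hasDerivAt.hasDerivWithinAt
      hasDerivWithinAt_traceRemainder_Iic_one
  linarith

/-- `δ` is continuous at `ρ = 1` (both one-sided derivatives exist). [cite: ConnesConsani2021, §2 eq. (25)–(26) p. 11 (chunk p0011:L10–L17)] -/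
theorem continuousAt_traceRemainder_one : ContinuousAt traceRemainder 1 :=
  continuousAt_iff_continuous_left_right.mpr
    ⟨hasDerivWithinAt_traceRemainder_Iic_one.continuousWithinAt,
      hasDerivWithinAt_traceRemainder_Ici_one.continuousWithinAt⟩

/-- **`δ` is a continuous function on `ℝ₊*`** ("`δ(ρ)` is a function", §2 p. 10).  PROVED.
[cite: ConnesConsani2021, §2 p. 10 (chunk p0010:L12), eq. (25)–(26) p. 11] -/
theorem continuousOn_traceRemainder : ContinuousOn traceRemainder (Ioi 0) := by
  intro ρ₀ hρ₀
  refine ContinuousAt.continuousWithinAt ?_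
  rcases eq_or_ne ρ₀ 1 with rfl | h1
  · exact continuousAt_traceRemainder_one
  -- away from `1`: `δ = F ∘ (ρ ↦ max ρ ρ⁻¹)` near `ρ₀`, with `F` the closed form without the `if`
  set F : ℝ → ℝ := fun r => 2 * Real.sqrt r *
    (sinIntegral (2 * π * (1 + r)) / (2 * π * (1 + r)) +
      sinIntegral (2 * π * (r - 1)) / (2 * π * (r - 1))) with hF
  have hm : ContinuousAt (fun ρ : ℝ => max ρ ρ⁻¹) ρ₀ :=
    continuousAt_id.max (continuousAt_inv₀ hρ₀.ne')
  have hm1 : ∀ ρ : ℝ, ρ ≠ 1 → 0 < ρ → max ρ ρ⁻¹ ≠ 1 := by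
    intro ρ hρ hρ0 h
    rcases le_total ρ ρ⁻¹ with hle | hle
    · rw [max_eq_right hle] at h
      exact hρ (inv_eq_one.mp h)
    · rw [max_eq_left hle] at h
      exact hρ h
  have hFc : ContinuousAt F (max ρ₀ ρ₀⁻¹) := by
    have hne : max ρ₀ ρ₀⁻¹ ≠ 1 := hm1 ρ₀ h1 hρ₀
    have hpos : 0 < max ρ₀ ρ₀⁻¹ := lt_max_of_lt_left hρ₀
    refine ((continuousAt_const.mul (Real.continuous_sqrt.continuousAt))).mul
      (ContinuousAt.add ?_ ?_)
    · exact ((continuous_sinIntegral.continuousAt).comp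
        (by fun_prop : ContinuousAt (fun r : ℝ => 2 * π * (1 + r)) _)).div
        (by fun_prop) (by positivity)
    · exact ((continuous_sinIntegral.continuousAt).comp
        (by fun_prop : ContinuousAt (fun r : ℝ => 2 * π * (r - 1)) _)).div
        (by fun_prop) (mul_ne_zero (by positivity) (sub_ne_zero.mpr hne))
  have hev : (fun ρ => F (max ρ ρ⁻¹)) =ᶠ[𝓝 ρ₀] traceRemainder := by
    have hopen : IsOpen ({ρ : ℝ | ρ ≠ 1} ∩ Ioi 0) := isOpen_ne.inter isOpen_Ioi
    filter_upwards [hopen.mem_nhds ⟨h1, hρ₀⟩] with ρ hρ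
    have hne := hm1 ρ hρ.1 hρ.2
    simp only [traceRemainder, traceRemainderAux, if_neg hne, hF]
  exact (hFc.comp_of_eq hm rfl).congr hev

/-- `u ↦ δ(eᵘ)` is continuous on `ℝ` (the additive avatar `δ ∘ exp` of `remainderD`). [cite: ConnesConsani2021, §2 eq. (25)–(26) p. 11 (chunk p0011:L10–L17)] -/
theorem continuous_traceRemainder_exp : Continuous fun u : ℝ => traceRemainder (Real.exp u) :=
  continuousOn_traceRemainder.comp_continuous Real.continuous_exp fun u => Real.exp_pos u

end Literature.NumberTheory.ConnesConsani2021

end
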